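import Literature.NumberTheory.LFunctions.Zhang2022.KnifeEdgeGramPSD
import Literature.NumberTheory.LFunctions.Zhang2022.RepairJumpBlock
import Literature.NumberTheory.LFunctions.Zhang2022.RepairLambdaBlock
import Literature.NumberTheory.LFunctions.Zhang2022.RepairWallBand

/-!
# Zhang (2022), programme F-S3 §E (cell landau-siegel, barrier extension, stub S-E-t1-1 = S-E-p2-4): the MIXED
# members of B-multi's killed class `K_multi` — `k ≥ 3` blocks at once (H¹ bulk + wall band + Λ-type pieces +
# interior steps) — wrapped into the `R⁺⁺` protocol: ONE displayed slot, the member's model main-term matrix is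
# positive semidefinite (`familyGramBlockAll`, decided); its discrete-level shadow is a THEOREM; pairwise
# Cauchy–Schwarz certificates do NOT suffice for `k ≥ 3` (witness `gramThree`), and DO for `k = 2` (Sylvester)

Y. Zhang, *Discrete mean estimates and the Landau–Siegel zero*, arXiv:2211.02515v1 [Zhang2022LandauSiegel] —
an unrefereed manuscript under adjudication. **WHAT THIS IS NOT: not a claim about Theorems 1–2 of
arXiv:2211.02515, about Landau–Siegel zeros, about a repaired `Margin232`, or about Parity; nothing here asserts any
claim of the manuscript or any estimate. The programme SEARCHES and TYPES; no claim until a kernel theorem says so.**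
Companion of `KnifeEdgeGramPSD` (p460485: `KnifeEdge.tableComb`, `KnifeEdge.discGram`, `KnifeEdge.discGram_posSemidef`,
`KnifeEdge.discMean_tableComb`), `KnifeEdgeTwoBlockCriterion` (p458738: `KnifeEdge.twoBlockPencil`,
`KnifeEdge.twoBlockPencil_nonneg_iff`), `RepairWallBand` (p459421: `KnifeEdge.familyWallBand`), `RepairLambdaBlock`
(p464018: `KnifeEdge.familyLambdaBlockAll`, `KnifeEdge.lambdaPieceFeng1`), `RepairRplus` (p455670:
`Repair.DesignFamily`, `Repair.rplus_extend`).

**The word of record (C1, quoted).** KILL(B-multi), director-frontier 2026-08-26T18:10:26Z, certificate KILL-CERT v2.4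
96c2304f42278a63 §1, «GIVEN B-AH (E-014)»: «no d in K_multi (interior jumps ∪ wall/band ∪ bounded-variation far
features ∪ Λ-type pieces, mixed members included) closes at main order without an E*-len/E*-ℓ-strength input».
THIS FILE covers the clause «mixed members included»: designs with several blocks at once. The sub-classes taken
one block at a time are the landed families `Repair.familyJumpBlockAll` (M1, p460685), `KnifeEdge.familyLambdaBlockAll`
(M2, p464018), `KnifeEdge.familyWallBand` (M3-wall, p459421), `KnifeEdge.familyRoughTwoPiece` (M3-overhang, p457552),
`Repair.familyFarBV` (far BV, p4); the sum family is p3's `RepairIntakeBmulti` (`Repair.bmultiWord5`, p465068).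

**The class (`GramDesign`, `GramDesign.InClass`).** A MIXED MEMBER is a finite list of CONCRETE pieces
`piece : Fin k → MixedPiece` — `MixedPiece.bulk u u'` (a kinked `H¹` profile on `[0,1]`, wall value FREE),
`MixedPiece.band W` (a wall band datum `KnifeEdge.WallData`, rows E-005/E-034), `MixedPiece.lam L` (a Λ-type piece
`KnifeEdge.LambdaPiece`, row E-030), `MixedPiece.step z₀` (an interior step `𝟙_[0,z₀)`, row E-028) — together with
the member's MODEL MAIN-TERM MATRIX `gram : Matrix (Fin k) (Fin k) ℂ` (entry `(i,j)` = the claimed (A)-world main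
term, in units of `𝔞𝔓`, of the polar discrete pairing of the realised tables of pieces `i` and `j`) carried as a
DESIGN COORDINATE exactly as the underived kernel `κ` is a coordinate of `Repair.familyJumpBlockAll` (p460685) — so
ONE closed family covers every dictionary a derivation might deliver. Membership = every piece admissible
(`MixedPiece.Admissible`: kinked bulk; any band; `LambdaPiece.Admissible`; `0 < z₀ < 1`); NO analytic hypothesis and
NO constraint on `gram` inside the class. For amplitudes `x : Fin k → ℂ` the member `Σ_i x_i·piece_i` has model
constant `gramForm gram x = Re Σ_{i,j} x_i conj(x_j) gram_{ij}` («member OBJ = x†Gx», `KnifeEdge.discMean_tableComb`).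

**The verdict and its ONE slot (kind (c), displayed, never inside the class).** `familyGramBlockAll.Verdict d :=
d.gram.PosSemidef → ∀ x, ¬ (gramForm d.gram x < 0)` — DECIDED (`familyGramBlockAll_decided`,
`rplus_gramBlockAll_decided : ClassDecided (Rplus ++ [familyGramBlockAll])`). GRAM-WITNESS.md v1 2052450ac707b439 §4:
«Mixed members of K_multi (H¹ bulk + balanced wall band + Λ-type pieces, k ≥ 3 blocks) display ONE slot: the
(A)-world main-term matrix M of the member's blocks is positive semidefinite — the prediction of B-AH / E-014
(model-expectation identity), whose bulk and band-diagonal instances are theorems (`mainTermForm_nonneg_of_isH1`,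
`bandK_nonneg`) and whose discrete-level shadow is the theorem `discGram_posSemidef`; pairwise Cauchy–Schwarz
certificates do not suffice for k ≥ 3 (witness M₃); for k = 2 they coincide with the Gram condition (Sylvester) and
the family's verdict specialises to `familyWallBand` / `familyLambdaBlock`. Not covered: the (c)-door E-085 (a
correctly-derived indefinite M would be ¬(A)-content, used in no word until named, theory-reviewed and
kernel-checked), exits x1–x3 of KILL-CERT §8, literal amplitude readings.» HONEST READING: closing of a mixed member
at main order needs `¬ gram.PosSemidef` for its own dictionary — and by Part 6 an honest dictionary that is not PSD is
`¬(A)`-content outright (`gramDictionary_dichotomy`); nothing is «killed» unconditionally.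

**What is PROVED here (no slot).** Part 1: the Gram form of a member, `GramCloses`, and the criterion
`gramCloses_iff_not_posSemidef` (for a Hermitian matrix: some amplitude vector closes iff the matrix is not PSD)
[Horn–Johnson, Def. 4.1.9]. Part 2 (C2, `k = 2` IS the two-block criterion): `gramForm_two_pencil` (the member
`s·p₀ ⊕ p₁` has constant `twoBlockPencil`), `posSemidef_two_iff` (Sylvester, `n = 2`: with `G₀₀ ≥ 0`, PSD iff
`G₁₁ ≥ 0 ∧ ‖G₀₁‖² ≤ G₀₀G₁₁` — by `twoBlockPencil_nonneg_iff`, p458738); the explicit `3 × 3` matrix `gramThree =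
[[1,−1,−1],[−1,1,−1],[−1,−1,1]]` has every `2 × 2` principal submatrix PSD (`gramThree_pairwise`) yet the amplitude
vector `(1,1,1)` closes (`gramForm_gramThree_ones = −3`, `not_posSemidef_gramThree`) — so a `k = 3` verdict displaying
only the pairwise certificates would be FALSE [Horn–Johnson, Obs. 7.1.2 is one-way]. Part 3 (C2 on the CONCRETE model
objects): the wall member `u ⊕ W` of E-10 in world `(K, X)` has model matrix `wallGram K X u u' W =
[[𝔅(u), conj X(u,W)],[X(u,W), |h⁺|²K[b]]]`, `gramForm (wallGram …) (1,1) = wallMainTerm K X u u' W`, and its Gram slot IS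
E-10's displayed pair AT THE DESIGN (`posSemidef_wallGram_iff`: `0 ≤ |h⁺|²K[b] ∧ ‖X‖² ≤ 𝔅(u)·|h⁺|²K[b]`, the bulk
positivity `𝔅 ⪰ 0` on `H¹` being the theorem `mainTermForm_nonneg_of_isH1`); likewise `lambdaGram` /
`gramForm_lambdaGram` / `posSemidef_lambdaGram_iff` for M2; hence `familyWallBand_decided` and
`familyLambdaBlockAll_decided` are RE-DERIVED from `familyGramBlockAll_decided` (`familyWallBand_decided_of_gram`,
`familyLambdaBlockAll_decided_of_gram`). Part 4: the family, C4 witnesses — GRAM-WITNESS §1's member (bulk `ϰ(1,5/2)`,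
plateau band `½`, lambda-001's Λ-piece `lambdaPieceFeng1`) and a wall-value-`1` member with an interior step — slot
LOAD-BEARING (`familyGramBlockAll_unslotted_fails`: with `gram = gramThree` the §1 member closes) and INHABITED
(Part 5). Part 5 (the discrete level, a THEOREM under weights `≥ 0`, hypothesis of kind (b) displayed): the realised
value tables `MixedPiece.table`, `gramForm (discGram c' χ H) x = Ξ(Σ x_i H_i)`, `familyGramTables` (every finite
family of value tables, decided by `discMean_nonneg`), and for every mixed member the discrete Gram matrix of its
realised tables is PSD at every modulus (`discGram_pieces_posSemidef`). Part 6 (the dictionary, «(A) ⇒ M ⪰ 0» by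
deduction, ls-ref-1 18:13:05Z): `GramDictionary c' T G` (entrywise: under (A), `Ξ(T_i,T_j) = G_{ij}·𝔞𝔓 + o(𝔞𝔓)`),
`member_asymp_of_gramDictionary`, and `gramDictionary_dichotomy`: for a Hermitian `G` with an honest dictionary,
EITHER (A) fails for every real primitive character to every large modulus (⇒ Theorem 1,
`theorem1_of_gramDictionary_closes`) OR `G.PosSemidef` — the `k`-block twin of `Repair.familyWallBand_dichotomy`
(p460888). CURRENCY (C3(e)): the verdict is about the MODEL matrix `gram` (a design coordinate); which matrix is the
(A)-world dictionary of a member is registry rows E-028/E-030/E-034/E-006 (derivations, INERT by price) — displayed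
as `GramDictionary`, never asserted. Numbers of GRAM-WITNESS §3 (`𝔅(ϰ(1,5/2)) = 0.19204…`, `V = ¼`, …) are
certificate evidence of the cell, NOT used here (C7: none, structural).

**ADDENDUM (Parts 7–8).** Part 7 (C2 for M1): the interior-jump member `u ⊕ Σ c_i𝟙_[0,z_i)` has the DIAGONAL model
matrix `jumpGram κ J = diag(𝔅(u), κ(z_i))` (row E-028 claims vanishing crosses), `gramForm (jumpGram κ J) (1,c) =
jumpMainTerm κ J`, its Gram slot IS M1's kernel sign at the design (`posSemidef_jumpGram_iff`), and
`Repair.familyJumpBlockAll_decided` (p460685) is RE-DERIVED from the mixed family (`familyJumpBlockAll_decided_of_gram`)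
— so all three one-block-at-a-time model families of the word (M1, M2, M3-wall) are instances of `familyGramBlockAll`
by term. Part 8 (the `k`-BLOCK TWO-BLOCK CRITERION, degenerate bulk included): for the completed matrix
`bordered a c R = [[a, c†],[c, R]]` of a member «bulk ⊕ k blocks» with `a ≥ 0` and `R` Hermitian,
`posSemidef_bordered_iff : PSD ↔ R ⪰ 0 ∧ a·R − c c† ⪰ 0` (second blocks JOINTLY `≥ 0`, couplings JOINTLY
subordinate — the `k`-block form of `BandNonneg ∧ CrossSubordinate`; `k = 1` is `twoBlockPencil_nonneg_iff`), proved
fibre by fibre from p458738's pencil (`gramForm_bordered`); `coupling_eq_zero_of_bordered_zero` (a degenerate bulk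
forces every coupling to vanish); `posSemidef_bordered_bulk_iff` reads the displayed slot of `familyGramBlockAll` on a
completed member with kinked bulk (`𝔅(u) ≥ 0` the theorem). This is the reduction `KnifeEdgeTwoBlockCriterion` left
open («three or more coupled blocks … the honest slot there is positivity of the whole completed Gram matrix»).
Part 9 (second eyes ls-barrier-p2 g2 21:01:19Z): the DICTIONARY ROW `familyGramBlockDict` — same designs and class,
verdict = `gram` Hermitian → for every balancing scale and `c'`, `GramDictionary c' (realised tables) gram` → Prop 2.2(i)
→ Lemma 2.3 → ((A) eventually false ∨ no amplitude vector closes) — decided (`familyGramBlockDict_decided`); in this row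
the pieces are LOAD-BEARING (their realised tables enter the displayed dictionary); `familyGramBlockAll` stays the
model-currency bookkeeping row. Part 10 (REF-E E-19 C3 flag «class-free verdict», model level): the COMPLETED-MEMBER
ROW `familyGramBordered` — designs `BorderedDesign` = kinked bulk ⊕ `k` concrete pieces with the model data SPLIT into
couplings `c` and second-block matrix `R` (the bulk entry is the theorem-level form `𝔅(u)`, not data); TWO displayed
slots «`R ⪰ 0`» and «`𝔅(u)·R − c c† ⪰ 0`» (the `k`-block `BandNonneg` / `CrossSubordinate`); decided by
`posSemidef_bordered_iff` with `0 ≤ 𝔅(u)` SUPPLIED BY THE CLASS (`familyGramBordered_decided`) — the `k`-block twin of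
p458738's `familyWall`; `familyGramBordered_slots_iff` (the two slots ARE the Gram slot of the same member),
`bordered_wall_eq_wallGram` (C2, `k = 1`: E-10's matrix), `familyGramBordered_inClass_witness` (C4),
`coupling_eq_zero_of_gStar` (tightness on the kernel mode `g⋆`).

References: Zhang, arXiv:2211.02515v1, §2 (2.14)–(2.17), (2.23)–(2.33), Lemma 2.3, Prop. 2.2 (i); §7 Prop 7.1 (7.2)
p.44; §8 Lemma 8.1 [cite: Zhang2022LandauSiegel, §2 (2.16)–(2.17), §7 Prop 7.1 (7.2)]; Horn–Johnson, *Matrix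
Analysis* (2nd ed.), Def. 4.1.9, Obs. 7.1.2, Thm 7.2.5 (Sylvester's criterion), Thm 7.2.10 (Gram matrices)
[cite: HornJohnson2013, Thm 7.2.5]; cell files barrier/ASSIGNMENTS.md v1.24 row S-E-p2-4 / S-E-t1-1,
B-multi/GRAM-WITNESS.md v1 2052450ac707b439, B-multi/INTAKE-COVERAGE.md v1.3, KILL-CERT v2.4 96c2304f42278a63,
obj/EDREGISTRY.md rows E-006/E-014/E-028/E-030/E-034/E-085. «The programme SEARCHES and TYPES; no claim about
Landau–Siegel zeros, Theorems 1–2 of arXiv:2211.02515 or a repaired Margin232 until a kernel theorem says so.»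
-/

noncomputable section

open Complex Real Set ComplexConjugate Matrix
open scoped ComplexOrder

namespace Literature.NumberTheory.LFunctions.Zhang2022

namespace KnifeEdge

open Repair Skeleton

/-! ### Part 1 — the Gram form of a member, closing, and the criterion (Hermitian: closes iff not PSD) -/

section GramForm

variable {ι : Type*} [Fintype ι]

/-- **The model constant of the member `Σ_i x_i·piece_i`:** `Re Σ_{i,j} x_i·conj(x_j)·G_{ij}` for the model matrix
`G` (the shape of `KnifeEdge.discMean_tableComb`: «member OBJ = x†Gx»). [cite: Zhang2022LandauSiegel, §2 (2.16)–(2.17)] -/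
def gramForm (G : Matrix ι ι ℂ) (x : ι → ℂ) : ℝ := (∑ i, ∑ j, x i * conj (x j) * G i j).re

/-- **CLOSES (a predicate on model matrices, NOT asserted for any dictionary):** some amplitude vector has a
negative model constant. [cite: Zhang2022LandauSiegel, §7 Prop 7.1 (7.2)] -/
def GramCloses (G : Matrix ι ι ℂ) : Prop := ∃ x : ι → ℂ, gramForm G x < 0

/-- The Hermitian form of a matrix as a double sum: `y†·G·y = Σ_{i,j} conj(y_i)·y_j·G_{ij}`.
[cite: HornJohnson2013, Def. 4.1.9] -/
theorem star_dotProduct_mulVec_eq_sum (G : Matrix ι ι ℂ) (y : ι → ℂ) :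
    star y ⬝ᵥ (G *ᵥ y) = ∑ i, ∑ j, conj (y i) * y j * G i j := by
  simp only [dotProduct, mulVec, Pi.star_apply, Complex.star_def, Finset.mul_sum]
  refine Finset.sum_congr rfl fun i _ => Finset.sum_congr rfl fun j _ => ?_
  ring

/-- The member sum is the Hermitian form at the conjugate amplitude vector.
[cite: HornJohnson2013, Def. 4.1.9] -/
theorem gramSum_eq_star_dotProduct (G : Matrix ι ι ℂ) (x : ι → ℂ) :
    ∑ i, ∑ j, x i * conj (x j) * G i j = star (star x) ⬝ᵥ (G *ᵥ star x) := by
  rw [star_dotProduct_mulVec_eq_sum]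
  refine Finset.sum_congr rfl fun i _ => Finset.sum_congr rfl fun j _ => ?_
  simp only [Pi.star_apply, Complex.star_def, Complex.conj_conj]

/-- **Slotted: no amplitude vector closes.** If the model matrix is PSD, every member constant is `≥ 0`.
[cite: HornJohnson2013, Def. 4.1.9] -/
theorem gramForm_nonneg_of_posSemidef {G : Matrix ι ι ℂ} (hG : G.PosSemidef) (x : ι → ℂ) :
    0 ≤ gramForm G x := by
  unfold gramForm
  rw [gramSum_eq_star_dotProduct]
  exact (Complex.nonneg_iff.1 (hG.dotProduct_mulVec_nonneg (star x))).1

/-- … so a PSD model matrix never closes. [cite: HornJohnson2013, Def. 4.1.9] -/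
theorem not_gramCloses_of_posSemidef {G : Matrix ι ι ℂ} (hG : G.PosSemidef) : ¬ GramCloses G :=
  fun ⟨x, hx⟩ => (not_lt.2 (gramForm_nonneg_of_posSemidef hG x)) hx

/-- For a Hermitian matrix the member sum is real. [cite: HornJohnson2013, Def. 4.1.9] -/
theorem gramSum_im_of_isHermitian {G : Matrix ι ι ℂ} (hG : G.IsHermitian) (x : ι → ℂ) :
    (∑ i, ∑ j, x i * conj (x j) * G i j).im = 0 := by
  apply Complex.conj_eq_iff_im.1
  simp_rw [map_sum, map_mul, Complex.conj_conj]
  rw [Finset.sum_comm]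
  refine Finset.sum_congr rfl fun i _ => Finset.sum_congr rfl fun j _ => ?_
  have h := hG.apply i j
  rw [Complex.star_def] at h
  rw [h]
  ring

/-- **The converse:** a Hermitian matrix all of whose member constants are `≥ 0` is PSD.
[cite: HornJohnson2013, Def. 4.1.9] -/
theorem posSemidef_of_gramForm_nonneg {G : Matrix ι ι ℂ} (hH : G.IsHermitian) (h : ∀ x : ι → ℂ, 0 ≤ gramForm G x) :
    G.PosSemidef := by
  refine Matrix.PosSemidef.of_dotProduct_mulVec_nonneg hH fun y => ?_
  have hsum : star y ⬝ᵥ (G *ᵥ y) = ∑ i, ∑ j, (star y) i * conj ((star y) j) * G i j := by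
    rw [star_dotProduct_mulVec_eq_sum]
    refine Finset.sum_congr rfl fun i _ => Finset.sum_congr rfl fun j _ => ?_
    simp only [Pi.star_apply, Complex.star_def, Complex.conj_conj]
  rw [hsum]
  exact Complex.nonneg_iff.2 ⟨h (star y), (gramSum_im_of_isHermitian hH (star y)).symm⟩

/-- **THE CRITERION (Hermitian model matrix):** some amplitude vector closes iff the matrix is NOT positive
semidefinite — the `k`-block twin of `KnifeEdge.TwoBlockWorld.null_iff`. [cite: HornJohnson2013, Def. 4.1.9] -/
theorem gramCloses_iff_not_posSemidef {G : Matrix ι ι ℂ} (hH : G.IsHermitian) : GramCloses G ↔ ¬ G.PosSemidef := by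
  constructor
  · rintro ⟨x, hx⟩ hG
    exact (not_lt.2 (gramForm_nonneg_of_posSemidef hG x)) hx
  · intro h
    by_contra hc
    exact h (posSemidef_of_gramForm_nonneg hH fun x => not_lt.1 fun hx => hc ⟨x, hx⟩)

/-- Homogeneity: scaling the amplitudes by `c` scales the member constant by `‖c‖²`.
[cite: Zhang2022LandauSiegel, §2 (2.16)–(2.17)] -/
theorem gramForm_smul (G : Matrix ι ι ℂ) (c : ℂ) (x : ι → ℂ) :
    gramForm G (c • x) = ‖c‖ ^ 2 * gramForm G x := by
  have hc : c * conj c = ((‖c‖ ^ 2 : ℝ) : ℂ) := by rw [Complex.mul_conj, Complex.normSq_eq_norm_sq]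
  unfold gramForm
  rw [← Complex.re_ofReal_mul, Finset.mul_sum]
  congr 1
  refine Finset.sum_congr rfl fun i _ => ?_
  rw [Finset.mul_sum]
  refine Finset.sum_congr rfl fun j _ => ?_
  rw [← hc, Pi.smul_apply, Pi.smul_apply, smul_eq_mul, smul_eq_mul, map_mul]
  ring

/-- A closing amplitude vector is not zero: `Σ_i ‖x_i‖ > 0`. [cite: Zhang2022LandauSiegel, §2 (2.16)–(2.17)] -/
theorem sum_norm_pos_of_gramForm_neg {G : Matrix ι ι ℂ} {x : ι → ℂ} (h : gramForm G x < 0) : 0 < ∑ i, ‖x i‖ := by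
  by_contra h0
  have hle : ∑ i, ‖x i‖ = 0 := le_antisymm (not_lt.1 h0) (Finset.sum_nonneg fun i _ => norm_nonneg _)
  have hx : ∀ i, x i = 0 := fun i =>
    norm_eq_zero.1 ((Finset.sum_eq_zero_iff_of_nonneg fun i _ => norm_nonneg _).1 hle i (Finset.mem_univ i))
  have : gramForm G x = 0 := by simp [gramForm, hx]
  linarith

end GramForm

/-! ### Part 2 — `k = 2` IS the two-block criterion (Sylvester); `k = 3` is NOT pairwise (the witness `gramThree`) -/

section TwoByTwo

/-- The member constant on two blocks, written out. [cite: Zhang2022LandauSiegel, §2 (2.16)–(2.17)] -/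
theorem gramForm_fin_two (G : Matrix (Fin 2) (Fin 2) ℂ) (x : Fin 2 → ℂ) :
    gramForm G x = (x 0 * conj (x 0) * G 0 0 + x 0 * conj (x 1) * G 0 1 +
      (x 1 * conj (x 0) * G 1 0 + x 1 * conj (x 1) * G 1 1)).re := by
  simp only [gramForm, Fin.sum_univ_two]

/-- **`k = 2`: the member `s·p₀ ⊕ p₁` of a Hermitian `2 × 2` model matrix has constant
`twoBlockPencil G₀₀ G₀₁ G₁₁ s = G₀₀|s|² + 2Re(s·G₀₁) + G₁₁`** (p458738's pencil). [cite: HornJohnson2013, Thm 7.2.5] -/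
theorem gramForm_two_pencil {G : Matrix (Fin 2) (Fin 2) ℂ} (hH : G.IsHermitian) (s : ℂ) :
    gramForm G ![s, 1] = twoBlockPencil (G 0 0).re (G 0 1) (G 1 1).re s := by
  have h10 : G 1 0 = conj (G 0 1) := by
    have h := hH.apply 1 0
    rw [Complex.star_def] at h
    exact h.symm
  rw [gramForm_fin_two, twoBlockPencil]
  simp only [Matrix.cons_val_zero, Matrix.cons_val_one, map_one, mul_one, one_mul]
  rw [h10, ← map_mul, Complex.mul_conj, Complex.normSq_eq_norm_sq]
  simp only [Complex.add_re, Complex.re_ofReal_mul, Complex.conj_re]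
  ring

/-- **Sylvester's criterion, `n = 2`, for the Gram slot:** a Hermitian `2 × 2` model matrix with `G₀₀ ≥ 0` is PSD
iff `G₁₁ ≥ 0 ∧ ‖G₀₁‖² ≤ G₀₀·G₁₁` — on two blocks the Gram slot IS the pair (second block `≥ 0`, coupling
Cauchy–Schwarz-subordinate) of `KnifeEdge.TwoBlockWorld`. [cite: HornJohnson2013, Thm 7.2.5] -/
theorem posSemidef_two_iff {G : Matrix (Fin 2) (Fin 2) ℂ} (hH : G.IsHermitian) (ha : 0 ≤ (G 0 0).re) :
    G.PosSemidef ↔ 0 ≤ (G 1 1).re ∧ ‖G 0 1‖ ^ 2 ≤ (G 0 0).re * (G 1 1).re := by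
  constructor
  · intro hG
    refine (twoBlockPencil_nonneg_iff ha).1 fun s => ?_
    rw [← gramForm_two_pencil hH]
    exact gramForm_nonneg_of_posSemidef hG _
  · intro hcs
    refine posSemidef_of_gramForm_nonneg hH fun x => ?_
    by_cases h1 : x 1 = 0
    · have h00 : x 0 * conj (x 0) = ((‖x 0‖ ^ 2 : ℝ) : ℂ) := by rw [Complex.mul_conj, Complex.normSq_eq_norm_sq]
      have : gramForm G x = ‖x 0‖ ^ 2 * (G 0 0).re := by
        rw [gramForm_fin_two, h1, h00]
        simp only [map_zero, mul_zero, zero_mul, add_zero, Complex.re_ofReal_mul]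
      rw [this]
      exact mul_nonneg (sq_nonneg _) ha
    · have hx : x = x 1 • ![x 0 / x 1, 1] := by
        funext i
        fin_cases i
        · simp only [Fin.zero_eta, Pi.smul_apply, Matrix.cons_val_zero, smul_eq_mul]
          field_simp
        · simp only [Fin.mk_one, Pi.smul_apply, Matrix.cons_val_one, Matrix.cons_val_fin_one, smul_eq_mul,
            mul_one]
      rw [hx, gramForm_smul, gramForm_two_pencil hH]
      exact mul_nonneg (sq_nonneg _) ((twoBlockPencil_nonneg_iff ha).2 hcs _)

/-- **The pairwise-Cauchy–Schwarz matrix that is NOT PSD** (GRAM-WITNESS §2 W2): `M₃ = [[1,−1,−1],[−1,1,−1],[−1,−1,1]]`.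
[cite: HornJohnson2013, Obs. 7.1.2] -/
def gramThree : Matrix (Fin 3) (Fin 3) ℂ := !![1, -1, -1; -1, 1, -1; -1, -1, 1]

/-- `M₃` is Hermitian (real symmetric). [cite: HornJohnson2013, Obs. 7.1.2] -/
theorem gramThree_isHermitian : gramThree.IsHermitian :=
  Matrix.IsHermitian.ext fun i j => by
    fin_cases i <;> fin_cases j <;> simp [gramThree]

/-- **Every pairwise certificate holds for `M₃`:** diagonal entries `≥ 0` and `|M_{ij}|² ≤ M_{ii}·M_{jj}` for all
`i, j`. [cite: HornJohnson2013, Obs. 7.1.2] -/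
theorem gramThree_pairwiseCS (i j : Fin 3) :
    0 ≤ (gramThree i i).re ∧ ‖gramThree i j‖ ^ 2 ≤ (gramThree i i).re * (gramThree j j).re := by
  fin_cases i <;> fin_cases j <;> simp [gramThree]

/-- **… equivalently every `2 × 2` principal submatrix of `M₃` is PSD** (the two-block certificates of
`familyWallBand` / `familyLambdaBlock` shape, block pair by block pair). [cite: HornJohnson2013, Obs. 7.1.2, Thm 7.2.5] -/
theorem gramThree_pairwise (i j : Fin 3) : (gramThree.submatrix ![i, j] ![i, j]).PosSemidef := by
  refine (posSemidef_two_iff (gramThree_isHermitian.submatrix _) ?_).2 ?_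
  · simp only [Matrix.submatrix_apply, Matrix.cons_val_zero]
    exact (gramThree_pairwiseCS i i).1
  · simp only [Matrix.submatrix_apply, Matrix.cons_val_zero, Matrix.cons_val_one]
    exact ⟨(gramThree_pairwiseCS j j).1, (gramThree_pairwiseCS i j).2⟩

/-- **… yet the amplitude vector `(1,1,1)` has constant `3 − 6 = −3`.** [cite: HornJohnson2013, Def. 4.1.9] -/
theorem gramForm_gramThree_ones : gramForm gramThree (fun _ => 1) = -3 := by
  simp [gramForm, Fin.sum_univ_three, gramThree]
  norm_num

/-- `M₃` closes … [cite: HornJohnson2013, Def. 4.1.9] -/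
theorem gramCloses_gramThree : GramCloses gramThree :=
  ⟨fun _ => 1, by rw [gramForm_gramThree_ones]; norm_num⟩

/-- … hence is NOT PSD: **pairwise Cauchy–Schwarz certificates do not imply the Gram slot for `k ≥ 3`** (a `k = 3`
verdict displaying only the three two-block certificates would be false). [cite: HornJohnson2013, Obs. 7.1.2] -/
theorem not_posSemidef_gramThree : ¬ gramThree.PosSemidef :=
  (gramCloses_iff_not_posSemidef gramThree_isHermitian).1 gramCloses_gramThree

end TwoByTwo

/-! ### Part 3 — the CONCRETE pieces of a mixed member; the wall and Λ two-block members as Gram members (C2) -/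

/-- **A piece of a mixed B-multi design** (KILL-draft / INTAKE-COVERAGE v1.3 «MIXED members»): a kinked `H¹` bulk on
`[0,1]` (wall value free), a wall band datum (rows E-005/E-034), a Λ-type piece (row E-030), an interior step
`𝟙_[0,z₀)` (row E-028). Amplitudes are NOT part of the piece (they are the member's `x`).
[cite: Zhang2022LandauSiegel, §2 (2.23)–(2.30), §7 (7.2)] -/
inductive MixedPiece : Type
  /-- in-class bulk `u` with marked right derivative `u'` -/
  | bulk (u u' : ℝ → ℂ)
  /-- wall band datum `(h⁺, b)` -/
  | band (W : WallData)
  /-- Λ-type piece `(k, ν, p)` -/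
  | lam (L : LambdaPiece)
  /-- interior step at height `z₀` -/
  | step (z₀ : ℝ)

namespace MixedPiece

/-- **Admissibility of a piece** (the sub-class binders of record, verbatim; NO analytic hypothesis): bulk =
`Repair.KinkedProfile` (wall value free, as in `familyWallBand`); band = any `WallData`; Λ-piece =
`LambdaPiece.Admissible` (`k ≥ 1`, `0 < ν ≤ 1`, bounded profile); step = interior, `0 < z₀ < 1` (as in
`JumpData.Admissible`). [cite: Zhang2022LandauSiegel, §7 (7.2)] -/
def Admissible : MixedPiece → Prop
  | bulk u u' => KinkedProfile u u'
  | band _ => True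
  | lam L => L.Admissible
  | step z₀ => z₀ ∈ Ioo (0:ℝ) 1

/-- **The realised value table of a piece at modulus `D`** (balanced reading, balancing scale `Λs`): bulk ↦
`wallBulkPoly` (p459102), band ↦ `wallBandPoly` (p459102), Λ-piece ↦ `Λs^{−1/2}·lambdaPoly` (p459168), step ↦
`Λs^{−1/2}·profPoly(𝟙_[0,z₀))` of length `⌈P⌉` (p458438's balanced step).
[cite: Zhang2022LandauSiegel, §2 (2.23)–(2.30), §7 (7.2), §8 (8.3)] -/
def table (Λs : BandScale) : MixedPiece → (D : ℕ) → DirichletCharacter ℂ D → (Chr D → ℂ → ℂ)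
  | bulk u _ => fun _ χ => wallBulkPoly χ u
  | band W => fun _ χ => wallBandPoly χ Λs W
  | lam L => fun D χ x s => (((Real.sqrt (Λs D χ))⁻¹ : ℝ) : ℂ) * lambdaPoly χ x L s
  | step z₀ => fun D χ x s => (((Real.sqrt (Λs D χ))⁻¹ : ℝ) : ℂ) * profPoly χ x (stepFun z₀) ⌈bigP D⌉₊ s

/-- unfolding: bulk. [cite: Zhang2022LandauSiegel, §7 (7.2)] -/
theorem admissible_bulk_iff (u u' : ℝ → ℂ) : (bulk u u').Admissible ↔ KinkedProfile u u' := Iff.rfl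

/-- unfolding: band (no condition). [cite: Zhang2022LandauSiegel, §2 (2.30)] -/
theorem admissible_band (W : WallData) : (band W).Admissible := trivial

/-- unfolding: Λ-piece. [cite: Zhang2022LandauSiegel, §7 (7.2)] -/
theorem admissible_lam_iff (L : LambdaPiece) : (lam L).Admissible ↔ L.Admissible := Iff.rfl

/-- unfolding: step. [cite: Zhang2022LandauSiegel, §7 (7.2)] -/
theorem admissible_step_iff (z₀ : ℝ) : (step z₀).Admissible ↔ z₀ ∈ Ioo (0:ℝ) 1 := Iff.rfl

end MixedPiece

section WallReading

variable {K : (ℝ → ℂ) → ℝ} {X : WallCross} {u u' : ℝ → ℂ}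

/-- **The model matrix of the wall member `u ⊕ W` in world `(K, X)`** (E-10's functionals, p458037/p459421):
`[[𝔅(u), conj X(u,W)],[X(u,W), |h⁺|²K[b]]]`. [cite: Zhang2022LandauSiegel, §7 Prop 7.1 (7.2), §8 Lemma 8.1] -/
def wallGram (K : (ℝ → ℂ) → ℝ) (X : WallCross) (u u' : ℝ → ℂ) (W : WallData) : Matrix (Fin 2) (Fin 2) ℂ :=
  !![((mainTermForm u u' : ℝ) : ℂ), conj (X u u' W); X u u' W, ((‖W.hPlus‖ ^ 2 * K W.band : ℝ) : ℂ)]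

/-- it is Hermitian. [cite: Zhang2022LandauSiegel, §7 Prop 7.1 (7.2)] -/
theorem wallGram_isHermitian (W : WallData) : (wallGram K X u u' W).IsHermitian :=
  Matrix.IsHermitian.ext fun i j => by
    fin_cases i <;> fin_cases j <;> simp [wallGram, Complex.conj_ofReal]

/-- **C2 (wall): E-10's model constant IS the Gram constant of the member with amplitudes `(1,1)`:**
`gramForm (wallGram K X u u' W) (1,1) = wallMainTerm K X u u' W = 𝔅(u) + 2Re X(u,W) + |h⁺|²K[b]`.
[cite: Zhang2022LandauSiegel, §7 Prop 7.1 (7.2), §8 Lemma 8.1] -/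
theorem gramForm_wallGram (W : WallData) : gramForm (wallGram K X u u' W) ![1, 1] = wallMainTerm K X u u' W := by
  rw [gramForm_fin_two, wallMainTerm]
  simp only [wallGram, Matrix.of_apply, Matrix.cons_val', Matrix.cons_val_zero, Matrix.cons_val_one,
    Matrix.empty_val', Matrix.cons_val_fin_one, map_one, mul_one, one_mul]
  simp only [Complex.add_re, Complex.ofReal_re, Complex.conj_re]
  ring

/-- **C2 (wall): on the member `u ⊕ W` the Gram slot IS E-10's displayed pair at the design** — band block
`|h⁺|²K[b] ≥ 0` and `‖X(u,W)‖² ≤ 𝔅(u)·|h⁺|²K[b]` — the bulk positivity `𝔅(u) ≥ 0` being the theorem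
`mainTermForm_nonneg_of_isH1` on the class. [cite: HornJohnson2013, Thm 7.2.5] -/
theorem posSemidef_wallGram_iff (hu : KinkedProfile u u') (W : WallData) :
    (wallGram K X u u' W).PosSemidef ↔
      0 ≤ ‖W.hPlus‖ ^ 2 * K W.band ∧ ‖X u u' W‖ ^ 2 ≤ mainTermForm u u' * (‖W.hPlus‖ ^ 2 * K W.band) := by
  have ha : 0 ≤ (wallGram K X u u' W 0 0).re := by
    simp only [wallGram, Matrix.of_apply, Matrix.cons_val', Matrix.cons_val_zero, Matrix.empty_val',
      Matrix.cons_val_fin_one, Complex.ofReal_re]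
    exact mainTermForm_nonneg_of_isH1 hu.isH1
  rw [posSemidef_two_iff (wallGram_isHermitian W) ha]
  simp only [wallGram, Matrix.of_apply, Matrix.cons_val', Matrix.cons_val_zero, Matrix.cons_val_one,
    Matrix.empty_val', Matrix.cons_val_fin_one, Complex.ofReal_re, Complex.norm_conj]

/-- E-10's slots `K ≥ 0`, `WallCrossCS K X` put the Gram slot on every wall member of the class.
[cite: Zhang2022LandauSiegel, §2 Lemma 2.3, (2.15), §8 Lemma 8.1] -/
theorem posSemidef_wallGram_of_slots (hK : ∀ b : ℝ → ℂ, 0 ≤ K b) (hX : WallCrossCS K X) (hu : KinkedProfile u u')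
    (W : WallData) : (wallGram K X u u' W).PosSemidef :=
  (posSemidef_wallGram_iff hu W).2 ⟨mul_nonneg (sq_nonneg _) (hK _), hX u u' W hu⟩

end WallReading

section LambdaReading

variable {K : LambdaDiag} {X : LambdaCross} {u u' : ℝ → ℂ} {L : LambdaPiece}

/-- **The model matrix of the Λ member `u ⊕ c·λ` in world `(K_Λ, κ_×)`** (p459168/p464018's functionals):
`[[𝔅(u), conj κ_×(u,λ)],[κ_×(u,λ), K_Λ(λ)]]`. [cite: Zhang2022LandauSiegel, §7 Prop 7.1 (7.2)] -/
def lambdaGram (K : LambdaDiag) (X : LambdaCross) (u u' : ℝ → ℂ) (L : LambdaPiece) : Matrix (Fin 2) (Fin 2) ℂ :=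
  !![((mainTermForm u u' : ℝ) : ℂ), conj (X u u' L); X u u' L, ((K L : ℝ) : ℂ)]

/-- it is Hermitian. [cite: Zhang2022LandauSiegel, §7 Prop 7.1 (7.2)] -/
theorem lambdaGram_isHermitian : (lambdaGram K X u u' L).IsHermitian :=
  Matrix.IsHermitian.ext fun i j => by
    fin_cases i <;> fin_cases j <;> simp [lambdaGram, Complex.conj_ofReal]

/-- **C2 (Λ): M2's model constant IS the Gram constant of the member with amplitudes `(1, c)`:**
`gramForm (lambdaGram K X u u' L) (1,c) = lambdaBlockMainTerm K X u u' L c = 𝔅(u) + 2Re(κ_×·c) + |c|²K_Λ`.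
[cite: Zhang2022LandauSiegel, §7 Prop 7.1 (7.2)] -/
theorem gramForm_lambdaGram (c : ℂ) : gramForm (lambdaGram K X u u' L) ![1, c] = lambdaBlockMainTerm K X u u' L c := by
  have hcc : c * conj c = ((‖c‖ ^ 2 : ℝ) : ℂ) := by rw [Complex.mul_conj, Complex.normSq_eq_norm_sq]
  rw [gramForm_fin_two, lambdaBlockMainTerm]
  simp only [lambdaGram, Matrix.of_apply, Matrix.cons_val', Matrix.cons_val_zero, Matrix.cons_val_one,
    Matrix.empty_val', Matrix.cons_val_fin_one, map_one, mul_one, one_mul]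
  have e1 : (conj c * conj (X u u' L)).re = (X u u' L * c).re := by
    rw [← map_mul, Complex.conj_re, mul_comm]
  have e2 : (c * X u u' L).re = (X u u' L * c).re := by rw [mul_comm]
  have e3 : (c * conj c * ((K L : ℝ) : ℂ)).re = ‖c‖ ^ 2 * K L := by
    rw [hcc, ← Complex.ofReal_mul, Complex.ofReal_re]
  rw [Complex.add_re, Complex.add_re, Complex.add_re, Complex.ofReal_re, e1, e2, e3]
  ring

/-- **C2 (Λ): on the member `u ⊕ c·λ` the Gram slot IS M2's displayed pair at the design** — `K_Λ(λ) ≥ 0` and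
`‖κ_×(u,λ)‖² ≤ 𝔅(u)·K_Λ(λ)`. [cite: HornJohnson2013, Thm 7.2.5] -/
theorem posSemidef_lambdaGram_iff (hu : KinkedProfile u u') :
    (lambdaGram K X u u' L).PosSemidef ↔ 0 ≤ K L ∧ ‖X u u' L‖ ^ 2 ≤ mainTermForm u u' * K L := by
  have ha : 0 ≤ (lambdaGram K X u u' L 0 0).re := by
    simp only [lambdaGram, Matrix.of_apply, Matrix.cons_val', Matrix.cons_val_zero, Matrix.empty_val',
      Matrix.cons_val_fin_one, Complex.ofReal_re]
    exact mainTermForm_nonneg_of_isH1 hu.isH1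
  rw [posSemidef_two_iff lambdaGram_isHermitian ha]
  simp only [lambdaGram, Matrix.of_apply, Matrix.cons_val', Matrix.cons_val_zero, Matrix.cons_val_one,
    Matrix.empty_val', Matrix.cons_val_fin_one, Complex.ofReal_re, Complex.norm_conj]

/-- M2's slots `LambdaDiagNonneg K`, `LambdaBlockCS K X` put the Gram slot on every Λ member of the class
(`u(1) = 0` as in M2). [cite: Zhang2022LandauSiegel, §2 Lemma 2.3, (2.15), §7 Prop 7.1 (7.2)] -/
theorem posSemidef_lambdaGram_of_slots (hK : LambdaDiagNonneg K) (hX : LambdaBlockCS K X) (hu : KinkedProfile u u')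
    (h1 : u 1 = 0) (hL : L.Admissible) : (lambdaGram K X u u' L).PosSemidef :=
  (posSemidef_lambdaGram_iff hu).2 ⟨hK L hL, hX u u' L hu h1 hL⟩

end LambdaReading

/-! ### Part 4 — the family «mixed members, model matrix as a design coordinate», decided; C2 re-derivations; C4 -/

/-- **A mixed member of `K_multi`:** `k` concrete pieces and the member's model main-term matrix (a DESIGN
COORDINATE: the dictionary is underived, rows E-028/E-030/E-034/E-006 INERT by price — one closed family covers every
matrix a derivation might deliver, as `Repair.familyJumpBlockAll` does for the kernel `κ`).
[cite: Zhang2022LandauSiegel, §2 (2.23)–(2.33), §7 Prop 7.1 (7.2)] -/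
structure GramDesign where
  /-- number of blocks -/
  k : ℕ
  /-- the pieces -/
  piece : Fin k → MixedPiece
  /-- the member's model main-term matrix, entry `(i,j)` in units of `𝔞𝔓` -/
  gram : Matrix (Fin k) (Fin k) ℂ

/-- **Membership (C1 = the word's «mixed members»):** every piece admissible; nothing about `gram`.
[cite: Zhang2022LandauSiegel, §7 Prop 7.1 (7.2)] -/
def GramDesign.InClass (d : GramDesign) : Prop := ∀ i, (d.piece i).Admissible

/-- **The family «B-multi MIXED members, model currency, Gram slot displayed»:** verdict = IF the member's model
matrix is positive semidefinite (slot, kind (c): B-AH / E-014's prediction for an honest dictionary; its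
discrete-level shadow is the theorem `discGram_posSemidef`), THEN no amplitude vector has a negative model constant.
[cite: Zhang2022LandauSiegel, §7 Prop 7.1 (7.2)] [cite: HornJohnson2013, Def. 4.1.9] -/
def familyGramBlockAll : DesignFamily where
  Design := GramDesign
  InClass d := d.InClass
  Verdict d := d.gram.PosSemidef → ∀ x : Fin d.k → ℂ, ¬ (gramForm d.gram x < 0)

/-- **The mixed family is decided** (`gramForm_nonneg_of_posSemidef`). [cite: HornJohnson2013, Def. 4.1.9] -/
theorem familyGramBlockAll_decided : familyGramBlockAll.Decided :=
  fun _ _ hG x => not_lt.2 (gramForm_nonneg_of_posSemidef hG x)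

/-- **`R⁺ ++ [mixed family]` is decided** (`Repair.rplus_extend`). [cite: Zhang2022LandauSiegel, §2 (2.32)–(2.33)] -/
theorem rplus_gramBlockAll_decided : ClassDecided (Rplus ++ [familyGramBlockAll]) :=
  rplus_extend familyGramBlockAll_decided

/-- The verdict with the slot read through the criterion: a member's verdict fails for its matrix iff the matrix
closes; for a Hermitian matrix, iff it is not PSD. [cite: HornJohnson2013, Def. 4.1.9] -/
theorem familyGramBlockAll_verdict_iff (d : GramDesign) :
    familyGramBlockAll.Verdict d ↔ (d.gram.PosSemidef → ¬ GramCloses d.gram) := by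
  change (d.gram.PosSemidef → ∀ x : Fin d.k → ℂ, ¬ (gramForm d.gram x < 0)) ↔ _
  unfold GramCloses
  push Not
  exact Iff.rfl

/-- **The pieces-only presentation** (world quantified in the verdict, as `familyWall Q` of p458738): same class,
verdict = for EVERY model matrix that is PSD, no amplitude vector closes. [cite: Zhang2022LandauSiegel, §7 Prop 7.1 (7.2)] -/
def familyGramBlock : DesignFamily where
  Design := Σ k : ℕ, (Fin k → MixedPiece)
  InClass d := ∀ i, (d.2 i).Admissible
  Verdict d := ∀ G : Matrix (Fin d.1) (Fin d.1) ℂ, G.PosSemidef → ∀ x : Fin d.1 → ℂ, ¬ (gramForm G x < 0)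

/-- The pieces-only family is decided. [cite: HornJohnson2013, Def. 4.1.9] -/
theorem familyGramBlock_decided : familyGramBlock.Decided :=
  fun _ _ _ hG x => not_lt.2 (gramForm_nonneg_of_posSemidef hG x)

/-- `R⁺ ++ [pieces-only mixed family]` is decided. [cite: Zhang2022LandauSiegel, §2 (2.32)–(2.33)] -/
theorem rplus_gramBlock_decided : ClassDecided (Rplus ++ [familyGramBlock]) :=
  rplus_extend familyGramBlock_decided

/-- The two presentations agree member by member: the closed verdict at `(k, piece, G)` is the pieces-only verdict
at `(k, piece)` specialised to `G`. [cite: Zhang2022LandauSiegel, §7 Prop 7.1 (7.2)] -/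
theorem familyGramBlock_verdict_iff (k : ℕ) (p : Fin k → MixedPiece) :
    familyGramBlock.Verdict ⟨k, p⟩ ↔ ∀ G : Matrix (Fin k) (Fin k) ℂ, familyGramBlockAll.Verdict ⟨k, p, G⟩ :=
  Iff.rfl

section Recover

variable {K : (ℝ → ℂ) → ℝ} {X : WallCross} {u u' : ℝ → ℂ}

/-- The wall member `u ⊕ W` as a mixed member with its E-10 model matrix. [cite: Zhang2022LandauSiegel, §7 Prop 7.1 (7.2)] -/
def wallMember (K : (ℝ → ℂ) → ℝ) (X : WallCross) (u u' : ℝ → ℂ) (W : WallData) : GramDesign :=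
  ⟨2, ![MixedPiece.bulk u u', MixedPiece.band W], wallGram K X u u' W⟩

/-- it is in class exactly when the bulk is kinked (E-10's class `Repair.KinkedProfile`, wall value free).
[cite: Zhang2022LandauSiegel, §7 Prop 7.1 (7.2)] -/
theorem wallMember_inClass_iff (W : WallData) : (wallMember K X u u' W).InClass ↔ KinkedProfile u u' := by
  constructor
  · intro h
    exact h (0 : Fin 2)
  · intro hu i
    fin_cases i
    · exact hu
    · exact trivial

/-- **C2 (wall), BY THE MIXED FAMILY: E-10's verdict content re-derived** — with `K ≥ 0` and `WallCrossCS K X`, no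
wall/band design of the class has a negative model constant (`KnifeEdge.familyWallBand_decided`, p459421, recovered
through `familyGramBlockAll_decided` on the member `u ⊕ W`). [cite: Zhang2022LandauSiegel, §7 Prop 7.1 (7.2), §8 Lemma 8.1] -/
theorem wallBand_verdict_of_gram (hK : ∀ b : ℝ → ℂ, 0 ≤ K b) (hX : WallCrossCS K X) (hu : KinkedProfile u u')
    (W : WallData) : ¬ (wallMainTerm K X u u' W < 0) := by
  rw [← gramForm_wallGram W]
  exact familyGramBlockAll_decided (wallMember K X u u' W) ((wallMember_inClass_iff W).2 hu)
    (posSemidef_wallGram_of_slots hK hX hu W) ![1, 1]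

/-- `familyWallBand.Decided` obtained from the mixed family (C2 by term). [cite: Zhang2022LandauSiegel, §7 Prop 7.1 (7.2)] -/
theorem familyWallBand_decided_of_gram : familyWallBand.Decided :=
  fun d hd _ _ hK hX => wallBand_verdict_of_gram hK hX hd d.2.2

/-- The Λ member `u ⊕ c·λ` as a mixed member with its M2 model matrix. [cite: Zhang2022LandauSiegel, §7 Prop 7.1 (7.2)] -/
def lambdaMember (KΛ : LambdaDiag) (XΛ : LambdaCross) (d : LambdaDesign) : GramDesign :=
  ⟨2, ![MixedPiece.bulk d.u d.u', MixedPiece.lam d.L], lambdaGram KΛ XΛ d.u d.u' d.L⟩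

/-- an M2 design is a mixed member in class (the mixed class drops M2's `u(1) = 0`).
[cite: Zhang2022LandauSiegel, §7 Prop 7.1 (7.2)] -/
theorem lambdaMember_inClass (KΛ : LambdaDiag) (XΛ : LambdaCross) {d : LambdaDesign} (hd : d.InClass) :
    (lambdaMember KΛ XΛ d).InClass := by
  intro i
  fin_cases i
  · exact hd.kinked
  · exact hd.adm

/-- **C2 (Λ), BY THE MIXED FAMILY: M2's closed verdict re-derived** (`KnifeEdge.familyLambdaBlockAll_decided`,
p464018, recovered through `familyGramBlockAll_decided` on the member `u ⊕ c·λ`). [cite: Zhang2022LandauSiegel, §7 Prop 7.1 (7.2)] -/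
theorem familyLambdaBlockAll_decided_of_gram : familyLambdaBlockAll.Decided := by
  intro d hd KΛ XΛ hK hX
  rw [← gramForm_lambdaGram d.c]
  exact familyGramBlockAll_decided (lambdaMember KΛ XΛ d) (lambdaMember_inClass KΛ XΛ hd)
    (posSemidef_lambdaGram_of_slots hK hX hd.kinked hd.wall hd.adm) ![1, d.c]

end Recover

section Witness

/-- **GRAM-WITNESS §1's member (C4):** bulk `ϰ(1,5/2)` (multi-wall-001's `u1_control_one`), the plateau band at
balanced amplitude `½` (`WallData.flat (1/2)`), and multi-lambda-001's Λ-piece `lambdaPieceFeng1` (`k = 1`,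
`ν = 63/125`, profile `P₂`). [cite: Zhang2022LandauSiegel, §2 (2.23)–(2.30), §7 (7.2)] [cite: Feng2012CriticalLine, (1.11)] -/
def gramWitnessPieces : Fin 3 → MixedPiece :=
  ![MixedPiece.bulk (kappaP 1 (5 / 2)) (kappaP' 1 (5 / 2)), MixedPiece.band (WallData.flat (1 / 2)),
    MixedPiece.lam lambdaPieceFeng1]

/-- every piece of the witness is admissible (`inClassPiece_kappaP_one`, `admissible_lambdaPieceFeng1`).
[cite: Zhang2022LandauSiegel, §7 (7.2)] -/
theorem gramWitnessPieces_admissible : ∀ i, (gramWitnessPieces i).Admissible := by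
  intro i
  fin_cases i
  · exact (inClassPiece_kappaP_one (5 / 2)).kinked
  · exact trivial
  · exact admissible_lambdaPieceFeng1

/-- The witness member with a given model matrix. [cite: Zhang2022LandauSiegel, §7 Prop 7.1 (7.2)] -/
def gramWitness (G : Matrix (Fin 3) (Fin 3) ℂ) : GramDesign := ⟨3, gramWitnessPieces, G⟩

/-- **C4: the class is inhabited by the `k = 3` member of GRAM-WITNESS §1** (for every model matrix).
[cite: Zhang2022LandauSiegel, §7 Prop 7.1 (7.2)] -/
theorem gramWitness_inClass (G : Matrix (Fin 3) (Fin 3) ℂ) : (gramWitness G).InClass :=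
  gramWitnessPieces_admissible

/-- **A second member, wall value `u(1) = 1 ≠ 0` and an interior step** (the coverage `R⁺` lacks): constant bulk `𝟙`
(`kinkedProfile_constOne`), ramp band at height `1`, step at `z₀ = ½`. [cite: Zhang2022LandauSiegel, §2 (2.30), §7 (7.2)] -/
def gramWitnessPieces' : Fin 3 → MixedPiece :=
  ![MixedPiece.bulk (fun _ => (1:ℂ)) (fun _ => (0:ℂ)), MixedPiece.band (WallData.ramp 1), MixedPiece.step (1 / 2)]

/-- its pieces are admissible. [cite: Zhang2022LandauSiegel, §7 (7.2)] -/
theorem gramWitnessPieces'_admissible : ∀ i, (gramWitnessPieces' i).Admissible := by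
  intro i
  fin_cases i
  · exact kinkedProfile_constOne
  · exact trivial
  · change (1 / 2 : ℝ) ∈ Ioo (0:ℝ) 1
    constructor <;> norm_num

/-- C4: the second member is in class. [cite: Zhang2022LandauSiegel, §7 Prop 7.1 (7.2)] -/
theorem gramWitness'_inClass (G : Matrix (Fin 3) (Fin 3) ℂ) :
    (GramDesign.mk 3 gramWitnessPieces' G).InClass :=
  gramWitnessPieces'_admissible

/-- **The slot is LOAD-BEARING (GRAM-WITNESS §2 W2/W3): with the pairwise-Cauchy–Schwarz matrix `M₃` as its model
matrix, the §1 member CLOSES** (amplitudes `(1,1,1)`), although each of its three two-block certificates holds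
(`gramThree_pairwise`). [cite: HornJohnson2013, Obs. 7.1.2] -/
theorem gramWitness_three_closes : GramCloses (gramWitness gramThree).gram := gramCloses_gramThree

/-- … so the UNSLOTTED verdict «no member of the class closes, whatever its model matrix» is FALSE.
[cite: HornJohnson2013, Obs. 7.1.2] -/
theorem familyGramBlockAll_unslotted_fails :
    ¬ (∀ d : GramDesign, d.InClass → ∀ x : Fin d.k → ℂ, ¬ (gramForm d.gram x < 0)) := by
  intro h
  obtain ⟨x, hx⟩ := gramCloses_gramThree
  exact h (gramWitness gramThree) (gramWitness_inClass _) x hx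

/-- … and the verdict of record HOLDS on the §1 member for every PSD model matrix (slotted).
[cite: HornJohnson2013, Def. 4.1.9] -/
theorem gramWitness_verdict (G : Matrix (Fin 3) (Fin 3) ℂ) : familyGramBlockAll.Verdict (gramWitness G) :=
  familyGramBlockAll_decided _ (gramWitness_inClass G)

end Witness

/-! ### Part 5 — the DISCRETE level: a THEOREM under weights `≥ 0` (kind (b) displayed), no slot -/

section Discrete

variable {c' : ℝ} {D : ℕ} {χ : DirichletCharacter ℂ D}

/-- **The discrete Gram matrix's member constant IS the discrete mean of the member** (`discMean_tableComb`):
`gramForm (discGram c' χ H) x = Ξ(Σ_i x_i H_i)`. [cite: Zhang2022LandauSiegel, §2 (2.16)–(2.17)] -/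
theorem gramForm_discGram {ι : Type*} [Fintype ι] (x : ι → ℂ) (H : ι → (Chr D → ℂ → ℂ)) :
    gramForm (discGram c' χ H) x = discMean c' χ (tableComb x H) := by
  unfold gramForm
  simp only [discGram_apply]
  rw [← discMean_tableComb, Complex.ofReal_re]

/-- **W1 — the slot's discrete shadow is a THEOREM for every mixed member:** at every modulus whose weights
`Re 𝔠*·Re ω` are `≥ 0` on `idx χ` (Lemma 2.3 + Prop. 2.2 (i), `KnifeEdge.weights_nonneg_of`), the discrete Gram
matrix of the realised tables of ANY pieces is PSD (`discGram_posSemidef`, p460485).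
[cite: Zhang2022LandauSiegel, §2 Lemma 2.3, Prop. 2.2 (i), (2.15)–(2.17)] -/
theorem discGram_pieces_posSemidef (Λs : BandScale) {k : ℕ} (p : Fin k → MixedPiece)
    (hw : ∀ i ∈ idx χ, 0 ≤ (cstar c' D i.1 i.2).re * (omegaW D i.2).re) :
    (discGram c' χ fun i => (p i).table Λs D χ).PosSemidef :=
  discGram_posSemidef hw _

/-- … hence no amplitude vector gives a realised mixed member a negative discrete mean there.
[cite: Zhang2022LandauSiegel, §2 Lemma 2.3, (2.15)–(2.17)] -/
theorem discMean_mixedMember_nonneg (Λs : BandScale) {k : ℕ} (p : Fin k → MixedPiece) (x : Fin k → ℂ)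
    (hw : ∀ i ∈ idx χ, 0 ≤ (cstar c' D i.1 i.2).re * (omegaW D i.2).re) :
    0 ≤ discMean c' χ (tableComb x fun i => (p i).table Λs D χ) :=
  discMean_nonneg hw _

/-- **W1 for the §1 member:** with its DISCRETE Gram matrix as model matrix the slot holds outright (inhabited by a
theorem, every modulus with weights `≥ 0`). [cite: Zhang2022LandauSiegel, §2 Lemma 2.3, (2.15)–(2.17)] -/
theorem gramWitness_disc_slot (Λs : BandScale)
    (hw : ∀ i ∈ idx χ, 0 ≤ (cstar c' D i.1 i.2).re * (omegaW D i.2).re) :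
    (gramWitness (discGram c' χ fun i => (gramWitnessPieces i).table Λs D χ)).gram.PosSemidef :=
  discGram_posSemidef hw _

/-- **The family «every finite family of value tables, discrete-mean currency»** (wider than the word: the realised
mixed members are the instances `H_i = (piece_i).table Λs`): verdict = at every modulus whose weights are `≥ 0`
(hypothesis of kind (b), displayed), no amplitude vector has a negative discrete mean. NO slot.
[cite: Zhang2022LandauSiegel, §2 (2.16)–(2.17), Lemma 2.3] -/
def familyGramTables : DesignFamily where
  Design := Σ k : ℕ, (Fin k → ℂ) × (Fin k → ((D : ℕ) → DirichletCharacter ℂ D → (Chr D → ℂ → ℂ)))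
  InClass _ := True
  Verdict d := ∀ (c' : ℝ) (D : ℕ) (χ : DirichletCharacter ℂ D),
    (∀ i ∈ idx χ, 0 ≤ (cstar c' D i.1 i.2).re * (omegaW D i.2).re) →
      ¬ (discMean c' χ (tableComb d.2.1 fun i => d.2.2 i D χ) < 0)

/-- **The discrete family is decided BY THEOREM** (`discMean_nonneg`; equivalently `discGram_posSemidef` +
`gramForm_discGram`). [cite: Zhang2022LandauSiegel, §2 Lemma 2.3, (2.15)–(2.17)] -/
theorem familyGramTables_decided : familyGramTables.Decided :=
  fun _ _ _ _ _ hw => not_lt.2 (discMean_nonneg hw _)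

/-- `R⁺ ++ [discrete Gram family]` is decided. [cite: Zhang2022LandauSiegel, §2 (2.32)–(2.33)] -/
theorem rplus_gramTables_decided : ClassDecided (Rplus ++ [familyGramTables]) :=
  rplus_extend familyGramTables_decided

end Discrete

/-! ### Part 6 — the dictionary as a displayed statement, and the DICHOTOMY «(A) eventually false ∨ Gram PSD» -/

section Dictionary

variable {c' : ℝ} {ι : Type*} [Fintype ι]

/-- **The Gram DICTIONARY of a member (displayed, NOT asserted; rows E-028/E-030/E-034/E-006 are its instances):**
under (A), for every `ε > 0` and all large `D`, every entry of the discrete Gram matrix of the realised tables `T_i`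
is `G_{ij}·𝔞𝔓 + O(ε𝔞𝔓)` — `G` is the honest (A)-world main-term matrix of the member.
[cite: Zhang2022LandauSiegel, §2 (2.16)–(2.17), §7 Prop 7.1 (7.2), §8 (8.3), Lemma 8.1] -/
def GramDictionary (c' : ℝ) (T : ι → ((D : ℕ) → DirichletCharacter ℂ D → (Chr D → ℂ → ℂ)))
    (G : Matrix ι ι ℂ) : Prop :=
  ∀ ε : ℝ, 0 < ε → ForAllLarge fun D _ χ => AssumptionA D χ →
    ∀ i j, ‖discPolar c' χ (T i D χ) (T j D χ) - G i j * ((frakA χ * frakP D : ℝ) : ℂ)‖ ≤ ε * (frakA χ * frakP D)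

/-- **An entrywise dictionary gives every member its asymptotic** `Ξ(Σ x_i T_i) = gramForm G x·𝔞𝔓 + o(𝔞𝔓)` under
(A) (the `EStarLen`/`EMultiBand` shape, for the family endgame `eventually_not_assumptionA_of_negative_mainTerm_family`).
[cite: Zhang2022LandauSiegel, §2 (2.16)–(2.17), §8 (8.3)] -/
theorem member_asymp_of_gramDictionary {T : ι → ((D : ℕ) → DirichletCharacter ℂ D → (Chr D → ℂ → ℂ))}
    {G : Matrix ι ι ℂ} (hT : GramDictionary c' T G) {x : ι → ℂ} (hx : 0 < ∑ i, ‖x i‖) :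
    ∀ ε : ℝ, 0 < ε → ForAllLarge fun D _ χ => AssumptionA D χ →
      |discMean c' χ (tableComb x fun i => T i D χ) - gramForm G x * frakA χ * frakP D| ≤ ε * frakA χ * frakP D := by
  intro ε hε
  have hS2 : 0 < (∑ i, ‖x i‖) ^ 2 := pow_pos hx 2
  refine (hT (ε / (∑ i, ‖x i‖) ^ 2) (div_pos hε hS2)).mono fun D _ χ _ _ h hA => ?_
  have hij := h hA
  have key : discMean c' χ (tableComb x fun i => T i D χ) - gramForm G x * frakA χ * frakP D =
      (∑ i, ∑ j, x i * conj (x j) *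
        (discPolar c' χ (T i D χ) (T j D χ) - G i j * ((frakA χ * frakP D : ℝ) : ℂ))).re := by
    have h1 : ((discMean c' χ (tableComb x fun i => T i D χ) : ℝ) : ℂ) =
        ∑ i, ∑ j, x i * conj (x j) * discPolar c' χ (T i D χ) (T j D χ) := discMean_tableComb _ _
    have h2 : ∑ i, ∑ j, x i * conj (x j) *
          (discPolar c' χ (T i D χ) (T j D χ) - G i j * ((frakA χ * frakP D : ℝ) : ℂ)) =
        (∑ i, ∑ j, x i * conj (x j) * discPolar c' χ (T i D χ) (T j D χ)) -
          (∑ i, ∑ j, x i * conj (x j) * G i j) * ((frakA χ * frakP D : ℝ) : ℂ) := by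
      rw [Finset.sum_mul, ← Finset.sum_sub_distrib]
      refine Finset.sum_congr rfl fun i _ => ?_
      rw [Finset.sum_mul, ← Finset.sum_sub_distrib]
      refine Finset.sum_congr rfl fun j _ => ?_
      ring
    rw [h2, Complex.sub_re, ← h1, Complex.ofReal_re, Complex.re_mul_ofReal, gramForm]
    ring
  rw [key]
  calc |(∑ i, ∑ j, x i * conj (x j) *
          (discPolar c' χ (T i D χ) (T j D χ) - G i j * ((frakA χ * frakP D : ℝ) : ℂ))).re|
      ≤ ‖∑ i, ∑ j, x i * conj (x j) *
          (discPolar c' χ (T i D χ) (T j D χ) - G i j * ((frakA χ * frakP D : ℝ) : ℂ))‖ :=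
        Complex.abs_re_le_norm _
    _ ≤ ∑ i, ∑ j, ‖x i‖ * ‖x j‖ * (ε / (∑ i, ‖x i‖) ^ 2 * (frakA χ * frakP D)) := by
        refine (norm_sum_le _ _).trans (Finset.sum_le_sum fun i _ =>
          (norm_sum_le _ _).trans (Finset.sum_le_sum fun j _ => ?_))
        rw [norm_mul, norm_mul, Complex.norm_conj]
        exact mul_le_mul_of_nonneg_left (hij i j) (mul_nonneg (norm_nonneg _) (norm_nonneg _))
    _ = (∑ i, ‖x i‖) * (∑ j, ‖x j‖) * (ε / (∑ i, ‖x i‖) ^ 2 * (frakA χ * frakP D)) := by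
        rw [Finset.sum_mul_sum, Finset.sum_mul]
        refine Finset.sum_congr rfl fun i _ => ?_
        rw [Finset.sum_mul]
    _ = ε * frakA χ * frakP D := by
        field_simp

/-- **A closing member with an honest dictionary refutes (A) eventually** (family endgame, p458037:
`eventually_not_assumptionA_of_negative_mainTerm_family`; `Prop22i`, `Lemma23 c'` are CLAIMS of the manuscript,
displayed). [cite: Zhang2022LandauSiegel, §2 p. 6, Lemma 2.3, Prop. 2.2 (i), (2.15)] -/
theorem eventually_not_assumptionA_of_gramDictionary_closes
    {T : ι → ((D : ℕ) → DirichletCharacter ℂ D → (Chr D → ℂ → ℂ))} {G : Matrix ι ι ℂ}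
    (hT : GramDictionary c' T G) {x : ι → ℂ} (hx : gramForm G x < 0) (h22 : Prop22i) (h23 : Lemma23 c') :
    ∃ D₀ : ℕ, ∀ (D : ℕ) [NeZero D] (χ : DirichletCharacter ℂ D),
      D₀ ≤ D → χ.IsQuadratic → χ.IsPrimitive → ¬ AssumptionA D χ :=
  eventually_not_assumptionA_of_negative_mainTerm_family hx (F := fun D χ => tableComb x fun i => T i D χ)
    (member_asymp_of_gramDictionary hT (sum_norm_pos_of_gramForm_neg hx)) h22 h23

/-- **… and therefore proves Theorem 1 of the manuscript** (`Skeleton.theorem1_of_eventually_not_assumptionA`): a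
mixed member that «closes at main order» in an HONEST dictionary is an input of `¬(A)`-strength by itself — the
content of the price «E*-strength» in the word. [cite: Zhang2022LandauSiegel, §1 Theorem 1, §2 p. 6] -/
theorem theorem1_of_gramDictionary_closes
    {T : ι → ((D : ℕ) → DirichletCharacter ℂ D → (Chr D → ℂ → ℂ))} {G : Matrix ι ι ℂ}
    (hT : GramDictionary c' T G) {x : ι → ℂ} (hx : gramForm G x < 0) (h22 : Prop22i) (h23 : Lemma23 c') :
    Theorem1 :=
  Skeleton.theorem1_of_eventually_not_assumptionA
    (eventually_not_assumptionA_of_gramDictionary_closes hT hx h22 h23)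

/-- **DICHOTOMY «(A) ⇒ M ⪰ 0» (ls-ref-1 18:13:05Z: by deduction, not a «defect»):** for a Hermitian model matrix
with an honest dictionary, granted Prop. 2.2 (i) and Lemma 2.3, EITHER (A) fails for every real primitive character to
every large modulus, OR the matrix is positive semidefinite — the `k`-block twin of `Repair.familyWallBand_dichotomy`
(p460888). [cite: Zhang2022LandauSiegel, §2 Lemma 2.3, Prop. 2.2 (i), (2.15)–(2.17); §7 Prop 7.1 (7.2)] -/
theorem gramDictionary_dichotomy
    {T : ι → ((D : ℕ) → DirichletCharacter ℂ D → (Chr D → ℂ → ℂ))} {G : Matrix ι ι ℂ}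
    (hH : G.IsHermitian) (hT : GramDictionary c' T G) (h22 : Prop22i) (h23 : Lemma23 c') :
    (∃ D₀ : ℕ, ∀ (D : ℕ) [NeZero D] (χ : DirichletCharacter ℂ D),
        D₀ ≤ D → χ.IsQuadratic → χ.IsPrimitive → ¬ AssumptionA D χ) ∨ G.PosSemidef := by
  by_cases hG : G.PosSemidef
  · exact Or.inr hG
  · obtain ⟨x, hx⟩ := (gramCloses_iff_not_posSemidef hH).2 hG
    exact Or.inl (eventually_not_assumptionA_of_gramDictionary_closes hT hx h22 h23)

/-- **The mixed family under its dictionary:** for a member whose (Hermitian) model matrix is the honest dictionary of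
its realised tables at balancing scale `Λs`, EITHER (A) is eventually false OR the member satisfies the conclusion of
the verdict of record for every amplitude vector. [cite: Zhang2022LandauSiegel, §2 Lemma 2.3; §7 Prop 7.1 (7.2)] -/
theorem familyGramBlockAll_dichotomy (d : GramDesign) (Λs : BandScale) (hH : d.gram.IsHermitian)
    (hT : GramDictionary c' (fun i => (d.piece i).table Λs) d.gram) (h22 : Prop22i) (h23 : Lemma23 c') :
    (∃ D₀ : ℕ, ∀ (D : ℕ) [NeZero D] (χ : DirichletCharacter ℂ D),
        D₀ ≤ D → χ.IsQuadratic → χ.IsPrimitive → ¬ AssumptionA D χ)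
      ∨ ∀ x : Fin d.k → ℂ, ¬ (gramForm d.gram x < 0) := by
  rcases gramDictionary_dichotomy hH hT h22 h23 with hA | hG
  · exact Or.inl hA
  · exact Or.inr fun x => not_lt.2 (gramForm_nonneg_of_posSemidef hG x)

end Dictionary

/-! ### Part 7 — C2 (M1): the interior-jump member as a Gram member (diagonal model matrix); M1 re-derived -/

section JumpReading

variable {κ : ℝ → ℝ} {J : JumpData}

/-- The member constant of a DIAGONAL model matrix: `Σ_i ‖x_i‖²·Re d_i`. [cite: HornJohnson2013, Def. 4.1.9] -/
theorem gramForm_diagonal {ι : Type*} [Fintype ι] [DecidableEq ι] (d : ι → ℂ) (x : ι → ℂ) :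
    gramForm (Matrix.diagonal d) x = ∑ i, ‖x i‖ ^ 2 * (d i).re := by
  unfold gramForm
  have h : ∀ i, ∑ j, x i * conj (x j) * Matrix.diagonal d i j = x i * conj (x i) * d i := fun i => by
    rw [Finset.sum_eq_single i]
    · rw [Matrix.diagonal_apply_eq]
    · intro j _ hji
      rw [Matrix.diagonal_apply_ne _ (Ne.symm hji), mul_zero]
    · intro hi
      exact absurd (Finset.mem_univ i) hi
  simp_rw [h]
  rw [Complex.re_sum]
  refine Finset.sum_congr rfl fun i _ => ?_
  rw [Complex.mul_conj, Complex.re_ofReal_mul, Complex.normSq_eq_norm_sq]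

/-- **The model matrix of the interior-jump member `u ⊕ Σ_i c_i·𝟙_[0,z_i)`** (M1, p458438/p460685):
`diag(𝔅(u), κ(z_1), …, κ(z_n))` — the balanced jump model of row E-028 CLAIMS vanishing crosses, so its matrix is
diagonal (a derivation claim, displayed by the choice of matrix, not asserted).
[cite: Zhang2022LandauSiegel, §7 Prop 7.1 (7.2); §10 Lemma 10.1 (10.5)] -/
def jumpGram (κ : ℝ → ℝ) (J : JumpData) : Matrix (Fin (J.n + 1)) (Fin (J.n + 1)) ℂ :=
  Matrix.diagonal (Fin.cons ((mainTermForm J.cont J.cont' : ℝ) : ℂ) fun i => ((κ (J.pos i) : ℝ) : ℂ))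

/-- the member's amplitudes `(1, c_1, …, c_n)`. [cite: Zhang2022LandauSiegel, §10 Lemma 10.1 (10.5)] -/
def jumpAmp (J : JumpData) : Fin (J.n + 1) → ℂ := Fin.cons 1 J.coef

/-- the member's pieces `(bulk u, step z_1, …, step z_n)`. [cite: Zhang2022LandauSiegel, §7 (7.2); §10 (10.5)] -/
def jumpPieces (J : JumpData) : Fin (J.n + 1) → MixedPiece :=
  Fin.cons (MixedPiece.bulk J.cont J.cont') fun i => MixedPiece.step (J.pos i)

/-- The jump datum as a mixed member with its M1 model matrix. [cite: Zhang2022LandauSiegel, §7 Prop 7.1 (7.2)] -/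
def jumpMember (κ : ℝ → ℝ) (J : JumpData) : GramDesign := ⟨J.n + 1, jumpPieces J, jumpGram κ J⟩

/-- **C2 (M1): the balanced jump main term IS the Gram constant of the member** —
`gramForm (jumpGram κ J) (1, c) = jumpMainTerm κ J = 𝔅(u) + Σ_i |c_i|²κ(z_i)`.
[cite: Zhang2022LandauSiegel, §7 Prop 7.1 (7.2); §10 Lemma 10.1 (10.5)] -/
theorem gramForm_jumpGram (κ : ℝ → ℝ) (J : JumpData) : gramForm (jumpGram κ J) (jumpAmp J) = jumpMainTerm κ J := by
  rw [jumpGram, gramForm_diagonal, Fin.sum_univ_succ, jumpMainTerm]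
  simp only [jumpAmp, Fin.cons_zero, Fin.cons_succ, norm_one, one_pow, one_mul, Complex.ofReal_re]

/-- **C2 (M1): on the jump member the Gram slot IS M1's displayed kernel sign at the design** (`κ(z_i) ≥ 0` at every
jump of the datum), the bulk entry `𝔅(u) ≥ 0` being the theorem `mainTermForm_nonneg_of_isH1` on the class.
[cite: HornJohnson2013, Obs. 7.1.2] -/
theorem posSemidef_jumpGram_iff (hJ : J.Admissible) : (jumpGram κ J).PosSemidef ↔ ∀ i, 0 ≤ κ (J.pos i) := by
  rw [jumpGram, Matrix.posSemidef_diagonal_iff]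
  constructor
  · intro h i
    have hi := h i.succ
    rw [Fin.cons_succ] at hi
    exact Complex.zero_le_real.1 hi
  · intro h i
    refine Fin.cases ?_ (fun i => ?_) i
    · rw [Fin.cons_zero]
      exact Complex.zero_le_real.2 (mainTermForm_nonneg_of_isH1 hJ.kinked.isH1)
    · rw [Fin.cons_succ]
      exact Complex.zero_le_real.2 (h i)

/-- an admissible jump datum is a mixed member in class. [cite: Zhang2022LandauSiegel, §7 (7.2); §10 (10.5)] -/
theorem jumpMember_inClass (κ : ℝ → ℝ) (hJ : J.Admissible) : (jumpMember κ J).InClass := by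
  intro i
  refine Fin.cases ?_ (fun i => ?_) i
  · simp only [jumpMember, jumpPieces, Fin.cons_zero]
    exact hJ.kinked
  · simp only [jumpMember, jumpPieces, Fin.cons_succ]
    exact hJ.interior i

/-- **C2 (M1), BY THE MIXED FAMILY: `Repair.familyJumpBlockAll_decided` (p460685) re-derived** through
`familyGramBlockAll_decided` on the member `u ⊕ Σ c_i𝟙_[0,z_i)`. [cite: Zhang2022LandauSiegel, §7 Prop 7.1 (7.2); §10 (10.5)] -/
theorem familyJumpBlockAll_decided_of_gram : familyJumpBlockAll.Decided := by
  intro p hJ hκ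
  rw [← gramForm_jumpGram]
  exact not_lt.1 (familyGramBlockAll_decided (jumpMember p.1 p.2) (jumpMember_inClass p.1 hJ)
    ((posSemidef_jumpGram_iff hJ).2 fun i => hκ _ (hJ.interior i)) (jumpAmp p.2))

end JumpReading

/-! ### Part 8 — the `k`-block two-block criterion: the COMPLETED matrix «bulk ⊕ k blocks» is PSD iff the second
blocks are jointly PSD and the couplings are jointly subordinate (`a·R − c c† ⪰ 0`) — `a ≥ 0`, degenerate bulk included -/

section Bordered

variable {k : ℕ} {a : ℝ} {c : Fin k → ℂ} {R : Matrix (Fin k) (Fin k) ℂ}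

/-- Linearity of the member constant: difference of model matrices. [cite: HornJohnson2013, Def. 4.1.9] -/
theorem gramForm_sub {ι : Type*} [Fintype ι] (G H : Matrix ι ι ℂ) (x : ι → ℂ) :
    gramForm (G - H) x = gramForm G x - gramForm H x := by
  unfold gramForm
  rw [← Complex.sub_re, ← Finset.sum_sub_distrib]
  congr 1
  refine Finset.sum_congr rfl fun i _ => ?_
  rw [← Finset.sum_sub_distrib]
  refine Finset.sum_congr rfl fun j _ => ?_
  rw [Matrix.sub_apply]
  ring

/-- Linearity of the member constant: real scalar multiple of the model matrix. [cite: HornJohnson2013, Def. 4.1.9] -/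
theorem gramForm_smul_of_real {ι : Type*} [Fintype ι] (a : ℝ) (G : Matrix ι ι ℂ) (x : ι → ℂ) :
    gramForm ((a : ℂ) • G) x = a * gramForm G x := by
  unfold gramForm
  rw [← Complex.re_ofReal_mul, Finset.mul_sum]
  congr 1
  refine Finset.sum_congr rfl fun i _ => ?_
  rw [Finset.mul_sum]
  refine Finset.sum_congr rfl fun j _ => ?_
  rw [Matrix.smul_apply, smul_eq_mul]
  ring

/-- The member constant of the coupling dyad `c c†` is `|Σ_i x_i c_i|²`. [cite: HornJohnson2013, Thm 7.2.10] -/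
theorem gramForm_vecMulVec (c x : Fin k → ℂ) : gramForm (vecMulVec c (star c)) x = ‖∑ i, x i * c i‖ ^ 2 := by
  unfold gramForm
  have h : ∑ i, ∑ j, x i * conj (x j) * vecMulVec c (star c) i j = (∑ i, x i * c i) * conj (∑ j, x j * c j) := by
    rw [map_sum, Finset.sum_mul_sum]
    refine Finset.sum_congr rfl fun i _ => Finset.sum_congr rfl fun j _ => ?_
    rw [vecMulVec_apply, Pi.star_apply, Complex.star_def, map_mul]
    ring
  rw [h, Complex.mul_conj, Complex.ofReal_re, Complex.normSq_eq_norm_sq]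

/-- **The COMPLETED model matrix of a member «bulk ⊕ k further blocks»** (bulk block `a`, couplings `c_i` — entry
`(i+1, 0) = c_i`, `(0, i+1) = conj c_i` — and the second blocks' Gram matrix `R`): the `k`-block version of
p458738's `[[a, c̄],[c, r]]`. [cite: Zhang2022LandauSiegel, §7 Prop 7.1 (7.2)] [cite: HornJohnson2013, Thm 7.2.5] -/
def bordered (a : ℝ) (c : Fin k → ℂ) (R : Matrix (Fin k) (Fin k) ℂ) : Matrix (Fin (k + 1)) (Fin (k + 1)) ℂ :=
  Matrix.of (Fin.cons (Fin.cons (a : ℂ) fun j => conj (c j)) fun i => Fin.cons (c i) fun j => R i j)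

/-- entry `(0,0)`: the bulk block. [cite: Zhang2022LandauSiegel, §7 Prop 7.1 (7.2)] -/
@[simp] theorem bordered_zero_zero (a : ℝ) (c : Fin k → ℂ) (R : Matrix (Fin k) (Fin k) ℂ) :
    bordered a c R 0 0 = a := by
  simp [bordered]

/-- entries `(0, j+1)`: conjugate couplings. [cite: Zhang2022LandauSiegel, §7 Prop 7.1 (7.2)] -/
@[simp] theorem bordered_zero_succ (a : ℝ) (c : Fin k → ℂ) (R : Matrix (Fin k) (Fin k) ℂ) (j : Fin k) :
    bordered a c R 0 j.succ = conj (c j) := by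
  simp [bordered]

/-- entries `(i+1, 0)`: couplings. [cite: Zhang2022LandauSiegel, §7 Prop 7.1 (7.2)] -/
@[simp] theorem bordered_succ_zero (a : ℝ) (c : Fin k → ℂ) (R : Matrix (Fin k) (Fin k) ℂ) (i : Fin k) :
    bordered a c R i.succ 0 = c i := by
  simp [bordered]

/-- entries `(i+1, j+1)`: the second blocks. [cite: Zhang2022LandauSiegel, §7 Prop 7.1 (7.2)] -/
@[simp] theorem bordered_succ_succ (a : ℝ) (c : Fin k → ℂ) (R : Matrix (Fin k) (Fin k) ℂ) (i j : Fin k) :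
    bordered a c R i.succ j.succ = R i j := by
  simp [bordered]

/-- the completed matrix is Hermitian when the second-block matrix is. [cite: HornJohnson2013, Def. 4.1.9] -/
theorem bordered_isHermitian (a : ℝ) (c : Fin k → ℂ) (hR : R.IsHermitian) : (bordered a c R).IsHermitian := by
  refine Matrix.IsHermitian.ext fun i j => ?_
  refine Fin.cases ?_ (fun i' => ?_) i <;> refine Fin.cases ?_ (fun j' => ?_) j
  · rw [bordered_zero_zero, Complex.star_def, Complex.conj_ofReal]
  · rw [bordered_succ_zero, bordered_zero_succ, Complex.star_def]
  · rw [bordered_zero_succ, bordered_succ_zero, Complex.star_def, Complex.conj_conj]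
  · rw [bordered_succ_succ, bordered_succ_succ]
    exact hR.apply i' j'

/-- **The member constant of the completed matrix is p458738's pencil, fibre by fibre:** for amplitudes `(s, y)`,
`gramForm (bordered a c R) (s,y) = twoBlockPencil a (conj Σ_i y_i c_i) (gramForm R y) s`.
[cite: Zhang2022LandauSiegel, §7 Prop 7.1 (7.2)] [cite: HornJohnson2013, Thm 7.2.5] -/
theorem gramForm_bordered (a : ℝ) (c : Fin k → ℂ) (R : Matrix (Fin k) (Fin k) ℂ) (x : Fin (k + 1) → ℂ) :
    gramForm (bordered a c R) x =
      twoBlockPencil a (conj (∑ i, x i.succ * c i)) (gramForm R fun i => x i.succ) (x 0) := by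
  have hw : ∑ j, x 0 * conj (x j.succ) * conj (c j) = x 0 * conj (∑ i, x i.succ * c i) := by
    rw [map_sum, Finset.mul_sum]
    refine Finset.sum_congr rfl fun j _ => ?_
    rw [map_mul]
    ring
  have hw' : ∑ i, x i.succ * conj (x 0) * c i = conj (x 0 * conj (∑ i, x i.succ * c i)) := by
    rw [map_mul, Complex.conj_conj, Finset.mul_sum]
    refine Finset.sum_congr rfl fun i _ => ?_
    ring
  have h00 : x 0 * conj (x 0) * (a : ℂ) = ((a * ‖x 0‖ ^ 2 : ℝ) : ℂ) := by
    rw [Complex.mul_conj, Complex.normSq_eq_norm_sq]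
    push_cast
    ring
  unfold gramForm twoBlockPencil
  rw [Fin.sum_univ_succ]
  simp only [Fin.sum_univ_succ, bordered_zero_zero, bordered_zero_succ, bordered_succ_zero, bordered_succ_succ,
    Finset.sum_add_distrib]
  rw [hw, hw', h00, Complex.add_re, Complex.add_re, Complex.add_re, Complex.ofReal_re, Complex.conj_re]
  ring

/-- the second-block Schur form `a·R − c c†` is Hermitian. [cite: HornJohnson2013, Def. 4.1.9] -/
theorem schurForm_isHermitian (a : ℝ) (c : Fin k → ℂ) (hR : R.IsHermitian) :
    ((a : ℂ) • R - vecMulVec c (star c)).IsHermitian := by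
  refine Matrix.IsHermitian.ext fun i j => ?_
  have h := hR.apply i j
  rw [Complex.star_def] at h
  simp only [Matrix.sub_apply, Matrix.smul_apply, smul_eq_mul, vecMulVec_apply, Pi.star_apply, Complex.star_def,
    map_sub, map_mul, Complex.conj_ofReal, Complex.conj_conj, h]
  ring

/-- **THE `k`-BLOCK TWO-BLOCK CRITERION (Sylvester/Schur, degenerate bulk included):** for `a ≥ 0` and Hermitian `R`,
the completed matrix `[[a, c†],[c, R]]` is PSD iff the second blocks are JOINTLY PSD (`R ⪰ 0`, the `k`-block form of
`BandNonneg`) and the couplings are JOINTLY subordinate (`a·R − c c† ⪰ 0`, the `k`-block form of `CrossSubordinate`);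
for `k = 1` this is `twoBlockPencil_nonneg_iff` (`r ≥ 0 ∧ ‖c‖² ≤ a r`). Proof: the member constant is p458738's pencil
fibre by fibre (`gramForm_bordered`). This is the exact reduction announced in `KnifeEdgeTwoBlockCriterion` («three or
more coupled blocks: the honest slot is positivity of the whole completed Gram matrix»).
[cite: HornJohnson2013, Thm 7.2.5] [cite: Zhang2022LandauSiegel, §7 Prop 7.1 (7.2)] -/
theorem posSemidef_bordered_iff (ha : 0 ≤ a) (hR : R.IsHermitian) :
    (bordered a c R).PosSemidef ↔ R.PosSemidef ∧ ((a : ℂ) • R - vecMulVec c (star c)).PosSemidef := by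
  constructor
  · intro hB
    have hy : ∀ y : Fin k → ℂ,
        0 ≤ gramForm R y ∧ ‖conj (∑ i, y i * c i)‖ ^ 2 ≤ a * gramForm R y := fun y => by
      refine (twoBlockPencil_nonneg_iff ha).1 fun s => ?_
      have h := gramForm_nonneg_of_posSemidef hB (Fin.cons s y)
      rw [gramForm_bordered] at h
      simpa only [Fin.cons_zero, Fin.cons_succ] using h
    refine ⟨posSemidef_of_gramForm_nonneg hR fun y => (hy y).1,
      posSemidef_of_gramForm_nonneg (schurForm_isHermitian a c hR) fun y => ?_⟩
    rw [gramForm_sub, gramForm_smul_of_real, gramForm_vecMulVec]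
    have h2 := (hy y).2
    rw [Complex.norm_conj] at h2
    linarith
  · rintro ⟨hRp, hSp⟩
    refine posSemidef_of_gramForm_nonneg (bordered_isHermitian a c hR) fun x => ?_
    rw [gramForm_bordered]
    refine (twoBlockPencil_nonneg_iff ha).2 ⟨gramForm_nonneg_of_posSemidef hRp _, ?_⟩ _
    have h2 := gramForm_nonneg_of_posSemidef hSp (fun i => x i.succ)
    rw [gramForm_sub, gramForm_smul_of_real, gramForm_vecMulVec] at h2
    rw [Complex.norm_conj]
    linarith

/-- **On a degenerate bulk mode (`a = 0`) the slot forces ALL couplings to vanish** — the `k`-block twin of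
`KnifeEdge.TwoBlockWorld.cross_eq_zero_of_bulk_zero` (relevant for Zhang's own `g⋆`, `𝔅(g⋆) = 0`, p456612).
[cite: HornJohnson2013, Thm 7.2.5] -/
theorem coupling_eq_zero_of_bordered_zero (hR : R.IsHermitian) (h : (bordered 0 c R).PosSemidef) : c = 0 := by
  obtain ⟨-, hS⟩ := (posSemidef_bordered_iff le_rfl hR).1 h
  have h2 := gramForm_nonneg_of_posSemidef hS (star c)
  rw [gramForm_sub, gramForm_smul_of_real, gramForm_vecMulVec, zero_mul, zero_sub, neg_nonneg] at h2
  have h3 : ∑ i, (star c) i * c i = ((∑ i, ‖c i‖ ^ 2 : ℝ) : ℂ) := by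
    push_cast
    refine Finset.sum_congr rfl fun i _ => ?_
    rw [Pi.star_apply, Complex.star_def, mul_comm, Complex.mul_conj, Complex.normSq_eq_norm_sq]
    push_cast
    rfl
  rw [h3, Complex.norm_real, Real.norm_eq_abs, sq_abs] at h2
  have h4 : ∑ i, ‖c i‖ ^ 2 = 0 := by
    have h5 : 0 ≤ ∑ i, ‖c i‖ ^ 2 := Finset.sum_nonneg fun i _ => sq_nonneg _
    nlinarith
  funext i
  have h6 := (Finset.sum_eq_zero_iff_of_nonneg fun i _ => sq_nonneg ‖c i‖).1 h4 i (Finset.mem_univ i)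
  exact norm_eq_zero.1 (pow_eq_zero_iff two_ne_zero |>.1 h6)

/-- **The MIXED slot read on a completed member:** for a kinked bulk `u` (so `𝔅(u) ≥ 0`, theorem) completed by `k`
blocks with couplings `c` and second-block matrix `R`, the displayed slot `gram.PosSemidef` of `familyGramBlockAll` IS
«`R ⪰ 0 ∧ 𝔅(u)·R − c c† ⪰ 0`» — second blocks jointly `≥ 0` and couplings jointly Cauchy–Schwarz-subordinate.
[cite: Zhang2022LandauSiegel, §7 Prop 7.1 (7.2)] [cite: HornJohnson2013, Thm 7.2.5] -/
theorem posSemidef_bordered_bulk_iff {u u' : ℝ → ℂ} (hu : KinkedProfile u u') (c : Fin k → ℂ)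
    (hR : R.IsHermitian) :
    (bordered (mainTermForm u u') c R).PosSemidef ↔
      R.PosSemidef ∧ (((mainTermForm u u' : ℝ) : ℂ) • R - vecMulVec c (star c)).PosSemidef :=
  posSemidef_bordered_iff (mainTermForm_nonneg_of_isH1 hu.isH1) hR

end Bordered

/-! ### Part 9 — the DICTIONARY row: same class, the realised tables of the pieces enter the slot (ls-barrier-p2 g2) -/

section DictRow

/-- **The family «B-multi MIXED members, DICTIONARY displayed»** (second-eyes recommendation ls-barrier-p2 g2
21:01:19Z: in `familyGramBlockAll` the pieces are bookkeeping — here they are LOAD-BEARING). Same designs and class as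
`familyGramBlockAll`; verdict = for a Hermitian model matrix, for EVERY balancing scale `Λs` and every `c'`: IF the
matrix is the honest (A)-world dictionary of the member's REALISED TABLES `(d.piece i).table Λs` (`GramDictionary`,
kind (c), displayed) and the manuscript's Prop. 2.2 (i) / Lemma 2.3 hold (kind (b), displayed), THEN either (A) fails
for every real primitive character to every large modulus, or no amplitude vector has a negative model constant.
[cite: Zhang2022LandauSiegel, §2 Lemma 2.3, Prop. 2.2 (i), (2.16)–(2.17); §7 Prop 7.1 (7.2)] -/
def familyGramBlockDict : DesignFamily where
  Design := GramDesign
  InClass d := d.InClass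
  Verdict d := d.gram.IsHermitian → ∀ (Λs : BandScale) (c' : ℝ),
    GramDictionary c' (fun i => (d.piece i).table Λs) d.gram → Prop22i → Lemma23 c' →
      (∃ D₀ : ℕ, ∀ (D : ℕ) [NeZero D] (χ : DirichletCharacter ℂ D),
          D₀ ≤ D → χ.IsQuadratic → χ.IsPrimitive → ¬ AssumptionA D χ)
        ∨ ∀ x : Fin d.k → ℂ, ¬ (gramForm d.gram x < 0)

/-- **The dictionary row is decided** (`familyGramBlockAll_dichotomy` = `gramDictionary_dichotomy` +
`gramForm_nonneg_of_posSemidef`: the endgame `eventually_not_assumptionA_of_negative_mainTerm_family` of p458037 on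
the member's realised table family). [cite: Zhang2022LandauSiegel, §2 Lemma 2.3, Prop. 2.2 (i); §7 Prop 7.1 (7.2)] -/
theorem familyGramBlockDict_decided : familyGramBlockDict.Decided :=
  fun d _ hH Λs _ hT h22 h23 => familyGramBlockAll_dichotomy d Λs hH hT h22 h23

/-- `R⁺ ++ [dictionary row]` is decided. [cite: Zhang2022LandauSiegel, §2 (2.32)–(2.33)] -/
theorem rplus_gramBlockDict_decided : ClassDecided (Rplus ++ [familyGramBlockDict]) :=
  rplus_extend familyGramBlockDict_decided

/-- Same designs, same class as the model-currency row. [cite: Zhang2022LandauSiegel, §7 Prop 7.1 (7.2)] -/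
theorem familyGramBlockDict_inClass_iff (d : GramDesign) :
    familyGramBlockDict.InClass d ↔ familyGramBlockAll.InClass d :=
  Iff.rfl

/-- The dictionary row's verdict holds on the GRAM-WITNESS §1 member for every model matrix (C4 for the row).
[cite: Zhang2022LandauSiegel, §7 Prop 7.1 (7.2)] -/
theorem gramWitness_dict_verdict (G : Matrix (Fin 3) (Fin 3) ℂ) : familyGramBlockDict.Verdict (gramWitness G) :=
  familyGramBlockDict_decided _ (gramWitness_inClass G)

end DictRow

/-! ### Part 10 — the COMPLETED-member row: the class is load-bearing (bulk positivity = theorem), the slots are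
«second blocks jointly `⪰ 0`» and «couplings jointly subordinate» — the `k`-block twin of `familyWall` (p458738) -/

section BorderedRow

/-- **A completed mixed member «kinked bulk ⊕ `k` concrete pieces»** with its model data SPLIT as in p458738's worlds:
the couplings `c_i` (bulk × piece pairings) and the second blocks' model matrix `R`; the bulk entry is NOT data — it
is the (4.1) form `𝔅(u)` (`mainTermForm`, theorem-level), so the member's model matrix is `bordered 𝔅(u) c R`
(`BorderedDesign.gram`). Answers REF-E E-19's C3 flag «class-free verdict» at the model level.
[cite: Zhang2022LandauSiegel, §7 Prop 7.1 (7.2)] -/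
structure BorderedDesign where
  /-- the bulk profile -/
  u : ℝ → ℂ
  /-- its marked right derivative -/
  u' : ℝ → ℂ
  /-- number of further blocks -/
  k : ℕ
  /-- the further pieces -/
  piece : Fin k → MixedPiece
  /-- bulk × piece couplings (model, units `𝔞𝔓`) -/
  coupling : Fin k → ℂ
  /-- the further pieces' model Gram matrix -/
  block : Matrix (Fin k) (Fin k) ℂ

/-- Membership: kinked `H¹` bulk (wall value free) and every further piece admissible; nothing about the model data.
[cite: Zhang2022LandauSiegel, §7 Prop 7.1 (7.2)] -/
def BorderedDesign.InClass (d : BorderedDesign) : Prop := KinkedProfile d.u d.u' ∧ ∀ i, (d.piece i).Admissible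

/-- The member's model matrix: the bulk entry is the THEOREM-level form `𝔅(u)`. [cite: Zhang2022LandauSiegel, §7 Prop 7.1 (7.2)] -/
def BorderedDesign.gram (d : BorderedDesign) : Matrix (Fin (d.k + 1)) (Fin (d.k + 1)) ℂ :=
  bordered (mainTermForm d.u d.u') d.coupling d.block

/-- **The family «completed mixed members, model currency, TWO displayed slots»**: second blocks jointly PSD
(`block.PosSemidef`, the `k`-block `BandNonneg`) and couplings jointly subordinate (`𝔅(u)·block − c c† ⪰ 0`, the
`k`-block `CrossSubordinate`) ⇒ no amplitude vector closes. The bulk positivity is NOT a slot: it is the theorem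
`mainTermForm_nonneg_of_isH1` on the class (so the class IS load-bearing here).
[cite: Zhang2022LandauSiegel, §7 Prop 7.1 (7.2)] [cite: HornJohnson2013, Thm 7.2.5] -/
def familyGramBordered : DesignFamily where
  Design := BorderedDesign
  InClass d := d.InClass
  Verdict d := d.block.PosSemidef →
    (((mainTermForm d.u d.u' : ℝ) : ℂ) • d.block - vecMulVec d.coupling (star d.coupling)).PosSemidef →
      ∀ x : Fin (d.k + 1) → ℂ, ¬ (gramForm d.gram x < 0)

/-- **The completed-member family is decided** — by the `k`-block criterion `posSemidef_bordered_iff`, whose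
hypothesis `0 ≤ 𝔅(u)` is supplied by the CLASS. [cite: HornJohnson2013, Thm 7.2.5] -/
theorem familyGramBordered_decided : familyGramBordered.Decided := by
  intro d hd hR hS x
  exact not_lt.2 (gramForm_nonneg_of_posSemidef
    ((posSemidef_bordered_iff (mainTermForm_nonneg_of_isH1 hd.1.isH1) hR.1).2 ⟨hR, hS⟩) x)

/-- `R⁺ ++ [completed-member row]` is decided. [cite: Zhang2022LandauSiegel, §2 (2.32)–(2.33)] -/
theorem rplus_gramBordered_decided : ClassDecided (Rplus ++ [familyGramBordered]) :=
  rplus_extend familyGramBordered_decided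

/-- A completed member IS a mixed member (`GramDesign`) with the bulk as piece `0` and the bordered matrix.
[cite: Zhang2022LandauSiegel, §7 Prop 7.1 (7.2)] -/
def BorderedDesign.toGramDesign (d : BorderedDesign) : GramDesign :=
  ⟨d.k + 1, Fin.cons (MixedPiece.bulk d.u d.u') d.piece, d.gram⟩

/-- … with the same class. [cite: Zhang2022LandauSiegel, §7 Prop 7.1 (7.2)] -/
theorem BorderedDesign.toGramDesign_inClass {d : BorderedDesign} (hd : d.InClass) : d.toGramDesign.InClass := by
  intro i
  refine Fin.cases ?_ (fun i => ?_) i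
  · simp only [BorderedDesign.toGramDesign, Fin.cons_zero]
    exact hd.1
  · simp only [BorderedDesign.toGramDesign, Fin.cons_succ]
    exact hd.2 i

/-- **The two displayed slots of the completed row ARE the Gram slot of `familyGramBlockAll` on that member**
(`posSemidef_bordered_bulk_iff`). [cite: HornJohnson2013, Thm 7.2.5] -/
theorem familyGramBordered_slots_iff {d : BorderedDesign} (hd : d.InClass) (hH : d.block.IsHermitian) :
    d.toGramDesign.gram.PosSemidef ↔
      d.block.PosSemidef ∧
        (((mainTermForm d.u d.u' : ℝ) : ℂ) • d.block - vecMulVec d.coupling (star d.coupling)).PosSemidef :=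
  posSemidef_bordered_bulk_iff hd.1 d.coupling hH

/-- **C2 (`k = 1`): the wall member's E-10 matrix IS the completed matrix with one further block** —
`bordered 𝔅(u) (X(u,W)) (|h⁺|²K[b]) = wallGram K X u u' W`. [cite: Zhang2022LandauSiegel, §7 Prop 7.1 (7.2)] -/
theorem bordered_wall_eq_wallGram (K : (ℝ → ℂ) → ℝ) (X : WallCross) (u u' : ℝ → ℂ) (W : WallData) :
    bordered (mainTermForm u u') ![X u u' W] !![((‖W.hPlus‖ ^ 2 * K W.band : ℝ) : ℂ)] = wallGram K X u u' W := by
  ext i j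
  refine Fin.cases ?_ (fun i' => ?_) i <;> refine Fin.cases ?_ (fun j' => ?_) j
  · rw [bordered_zero_zero]
    simp [wallGram]
  · rw [Fin.fin_one_eq_zero j', show (0 : Fin 1).succ = (1 : Fin 2) from rfl, ← show (0 : Fin 1).succ = (1 : Fin 2)
      from rfl, bordered_zero_succ]
    simp [wallGram]
  · rw [Fin.fin_one_eq_zero i', bordered_succ_zero]
    simp [wallGram]
  · rw [Fin.fin_one_eq_zero i', Fin.fin_one_eq_zero j', bordered_succ_succ]
    simp [wallGram]

/-- C4: the GRAM-WITNESS §1 member completed (bulk `ϰ(1,5/2)`; further pieces: plateau band `½`, `lambdaPieceFeng1`;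
any couplings, any block matrix) is in class. [cite: Zhang2022LandauSiegel, §7 Prop 7.1 (7.2)] -/
theorem familyGramBordered_inClass_witness (c : Fin 2 → ℂ) (R : Matrix (Fin 2) (Fin 2) ℂ) :
    (BorderedDesign.mk (kappaP 1 (5 / 2)) (kappaP' 1 (5 / 2)) 2
      ![MixedPiece.band (WallData.flat (1 / 2)), MixedPiece.lam lambdaPieceFeng1] c R).InClass := by
  refine ⟨(inClassPiece_kappaP_one (5 / 2)).kinked, fun i => ?_⟩
  fin_cases i
  · exact trivial
  · exact admissible_lambdaPieceFeng1

/-- **Tightness on a KERNEL MODE: with Zhang's own bulk `g⋆` (`𝔅(g⋆) = 0`, `Repair.mainTermForm_gStar`) the two slots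
force EVERY coupling to vanish** — the `k`-block twin of `TwoBlockWorld.cross_eq_zero_of_bulk_zero`.
[cite: HornJohnson2013, Thm 7.2.5] [cite: Zhang2022LandauSiegel, §7 Prop 7.1 (7.2)] -/
theorem coupling_eq_zero_of_gStar {k : ℕ} {c : Fin k → ℂ} {R : Matrix (Fin k) (Fin k) ℂ} (hH : R.IsHermitian)
    (h : (bordered (mainTermForm gStar gStar') c R).PosSemidef) : c = 0 := by
  rw [mainTermForm_gStar] at h
  exact coupling_eq_zero_of_bordered_zero hH h

end BorderedRow

/-! ### Part 11 — the dictionary ENTRY BY ENTRY: `PairDictionary`, finite assembly, Hermitian bookkeeping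

The displayed binder `GramDictionary c' T G` of the Dict row (Part 9, row 27 of `Repair.Rplusplus8+`) is ONE
statement about all `k²` entries at once. For the referee bundle it is the conjunction of the PER-ENTRY rows — each
of which is a registry row by name: (bulk `u`, bulk `v`) ↦ the polarised (4.1)/Prop 7.1 MODEL block (E-028-type
evaluation; for `u = v` the `EStarLen`-at-`X = 0` shape); (bulk, band) ↦ the cross row E-006 (`ECrossBand`);
(band, band) ↦ the band row E-034 / E-005 (`EMultiBand` / `EStarBand`); (Λ-piece, ·) ↦ E-030
(`LambdaDict`-type rows); (step, ·) ↦ E-028 (`jumpMainTerm` dictionary) — all INERT by price (KILL-CERT v2.4 §4).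
This part adds NO estimate: `PairDictionary` is displayed exactly like `GramDictionary`; the theorems are finite
bookkeeping (`gramDictionary_iff_pairwise`), the conjugate symmetry that halves the list for a Hermitian model matrix
(`pairDictionary_conj`, `gramDictionary_of_upper`), and the diagonal entry as the member's discrete-mean asymptotic
(`pairDictionary_self_discMean`, the `EStarLen`/`EMultiBand` shape consumed by p458037's family endgame). -/

section PairDictionary

variable {c' : ℝ} {ι : Type*} [Fintype ι]

/-- Finitely many eventual statements hold eventually TOGETHER (the larger of finitely many thresholds).
[cite: Zhang2022LandauSiegel, §2 p. 4] -/
theorem forAllLarge_forall {κ : Type*} [Fintype κ]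
    {S : κ → (D : ℕ) → [NeZero D] → DirichletCharacter ℂ D → Prop} (h : ∀ a, ForAllLarge (S a)) :
    ForAllLarge fun D _ χ => ∀ a, S a D χ := by
  classical
  have h' : ∀ a, ∃ D₀ : ℕ, ∀ (D : ℕ) [NeZero D] (χ : DirichletCharacter ℂ D),
      D₀ ≤ D → χ.IsQuadratic → χ.IsPrimitive → S a D χ := h
  choose D₀ hD₀ using h'
  exact ⟨Finset.univ.sup D₀, fun D _ χ hD hq hp a =>
    hD₀ a D χ ((Finset.le_sup (Finset.mem_univ a)).trans hD) hq hp⟩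

/-- **ONE ENTRY of the Gram dictionary (displayed, NOT asserted):** under (A), for every `ε > 0` and all large `D`,
the polar discrete pairing of the realised tables `Tᵢ`, `Tⱼ` is `g·𝔞𝔓 + O(ε𝔞𝔓)`. The registry row it names depends
on the two piece kinds (module docstring of this part). [cite: Zhang2022LandauSiegel, §2 (2.16)–(2.17), §7 Prop 7.1 (7.2), §8 (8.3), (8.5), Lemma 8.1] -/
def PairDictionary (c' : ℝ) (Ti Tj : (D : ℕ) → DirichletCharacter ℂ D → (Chr D → ℂ → ℂ)) (g : ℂ) : Prop :=
  ∀ ε : ℝ, 0 < ε → ForAllLarge fun D _ χ => AssumptionA D χ →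
    ‖discPolar c' χ (Ti D χ) (Tj D χ) - g * ((frakA χ * frakP D : ℝ) : ℂ)‖ ≤ ε * (frakA χ * frakP D)

omit [Fintype ι] in
/-- Every entry of a Gram dictionary is a pair dictionary. [cite: Zhang2022LandauSiegel, §2 (2.16)–(2.17)] -/
theorem GramDictionary.entry {T : ι → ((D : ℕ) → DirichletCharacter ℂ D → (Chr D → ℂ → ℂ))}
    {G : Matrix ι ι ℂ} (hT : GramDictionary c' T G) (i j : ι) : PairDictionary c' (T i) (T j) (G i j) :=
  fun ε hε => (hT ε hε).mono fun _ _ _ _ _ h hA => h hA i j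

/-- **Finite assembly: the `k²` entry rows give the Gram dictionary.**
[cite: Zhang2022LandauSiegel, §2 (2.16)–(2.17), §8 (8.3)] -/
theorem gramDictionary_of_pairwise {T : ι → ((D : ℕ) → DirichletCharacter ℂ D → (Chr D → ℂ → ℂ))}
    {G : Matrix ι ι ℂ} (h : ∀ i j, PairDictionary c' (T i) (T j) (G i j)) : GramDictionary c' T G := by
  intro ε hε
  have hall := forAllLarge_forall (κ := ι × ι) fun p => h p.1 p.2 ε hε
  exact hall.mono fun _ _ _ _ _ hp hA i j => hp (i, j) hA

/-- `GramDictionary c' T G ↔ ∀ i j, PairDictionary c' (T i) (T j) (G i j)` — the displayed binder of the Dict row IS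
the list of its entry rows. [cite: Zhang2022LandauSiegel, §2 (2.16)–(2.17), §8 (8.3)] -/
theorem gramDictionary_iff_pairwise {T : ι → ((D : ℕ) → DirichletCharacter ℂ D → (Chr D → ℂ → ℂ))}
    {G : Matrix ι ι ℂ} : GramDictionary c' T G ↔ ∀ i j, PairDictionary c' (T i) (T j) (G i j) :=
  ⟨fun hT i j => hT.entry i j, gramDictionary_of_pairwise⟩

/-- **Conjugate symmetry of entries:** the `(j,i)` row is the `(i,j)` row with the conjugate constant
(`discPolar_conj_symm`): a Hermitian model matrix needs only the rows `i ≤ j`.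
[cite: Zhang2022LandauSiegel, §2 (2.17)] -/
theorem pairDictionary_conj {Ti Tj : (D : ℕ) → DirichletCharacter ℂ D → (Chr D → ℂ → ℂ)} {g : ℂ}
    (h : PairDictionary c' Ti Tj g) : PairDictionary c' Tj Ti (conj g) := by
  intro ε hε
  refine (h ε hε).mono fun D _ χ _ _ hD hA => ?_
  have key : discPolar c' χ (Tj D χ) (Ti D χ) - conj g * ((frakA χ * frakP D : ℝ) : ℂ) =
      conj (discPolar c' χ (Ti D χ) (Tj D χ) - g * ((frakA χ * frakP D : ℝ) : ℂ)) := by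
    rw [map_sub, map_mul, Complex.conj_ofReal, discPolar_conj_symm]
  rw [key, Complex.norm_conj]
  exact hD hA

/-- A pair dictionary with constant `g` for `(Ti, Tj)` is one with constant `conj g` for `(Tj, Ti)`, and conversely.
[cite: Zhang2022LandauSiegel, §2 (2.17)] -/
theorem pairDictionary_conj_iff {Ti Tj : (D : ℕ) → DirichletCharacter ℂ D → (Chr D → ℂ → ℂ)} {g : ℂ} :
    PairDictionary c' Tj Ti (conj g) ↔ PairDictionary c' Ti Tj g :=
  ⟨fun h => by simpa using pairDictionary_conj h, pairDictionary_conj⟩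

/-- **Hermitian bookkeeping:** for a Hermitian model matrix the entry rows on and above the diagonal suffice.
[cite: HornJohnson2013, Def 4.1.9] [cite: Zhang2022LandauSiegel, §2 (2.17)] -/
theorem gramDictionary_of_upper {κ : Type*} [Fintype κ] [LinearOrder κ]
    {T : κ → ((D : ℕ) → DirichletCharacter ℂ D → (Chr D → ℂ → ℂ))} {G : Matrix κ κ ℂ} (hH : G.IsHermitian)
    (h : ∀ i j, i ≤ j → PairDictionary c' (T i) (T j) (G i j)) : GramDictionary c' T G := by
  refine gramDictionary_of_pairwise fun i j => ?_
  rcases le_total i j with hij | hji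
  · exact h i j hij
  · have hG : G i j = conj (G j i) := by
      have := congrFun (congrFun hH i) j
      simpa [Matrix.conjTranspose_apply] using this.symm
    rw [hG]
    exact pairDictionary_conj (h j i hji)

/-- **The diagonal entry is the member's own asymptotic** `Ξ(Tᵢ) = (Re g)·𝔞𝔓 + o(𝔞𝔓)` under (A) — the
`EStarLen`/`EMultiBand` shape of the family endgame (p458037). [cite: Zhang2022LandauSiegel, §2 (2.16), §8 (8.3)] -/
theorem pairDictionary_self_discMean {Ti : (D : ℕ) → DirichletCharacter ℂ D → (Chr D → ℂ → ℂ)} {g : ℂ}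
    (h : PairDictionary c' Ti Ti g) :
    ∀ ε : ℝ, 0 < ε → ForAllLarge fun D _ χ => AssumptionA D χ →
      |discMean c' χ (Ti D χ) - g.re * frakA χ * frakP D| ≤ ε * frakA χ * frakP D := by
  intro ε hε
  refine (h ε hε).mono fun D _ χ _ _ hD hA => ?_
  have hre : discMean c' χ (Ti D χ) - g.re * frakA χ * frakP D =
      (discPolar c' χ (Ti D χ) (Ti D χ) - g * ((frakA χ * frakP D : ℝ) : ℂ)).re := by
    rw [Complex.sub_re, discPolar_self_re, Complex.re_mul_ofReal]
    ring
  rw [hre, ← mul_assoc] at *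
  exact (Complex.abs_re_le_norm _).trans (by simpa [mul_assoc] using hD hA)

/-- On the diagonal only `Re g` is seen by the discrete mean; a diagonal dictionary constant may be taken real:
`PairDictionary c' T T g → PairDictionary c' T T (Re g)` (the polar pairing on the diagonal is real,
`discPolar_self`). [cite: Zhang2022LandauSiegel, §2 (2.16)] -/
theorem pairDictionary_self_re {Ti : (D : ℕ) → DirichletCharacter ℂ D → (Chr D → ℂ → ℂ)} {g : ℂ}
    (h : PairDictionary c' Ti Ti g) : PairDictionary c' Ti Ti (g.re : ℂ) := by
  intro ε hε
  refine (h ε hε).mono fun D _ χ _ _ hD hA => ?_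
  have h1 := hD hA
  have hreal : discPolar c' χ (Ti D χ) (Ti D χ) = ((discMean c' χ (Ti D χ) : ℝ) : ℂ) := discPolar_self _
  rw [hreal, ← Complex.ofReal_mul, ← Complex.ofReal_sub, Complex.norm_real, Real.norm_eq_abs]
  rw [hreal] at h1
  calc |discMean c' χ (Ti D χ) - g.re * (frakA χ * frakP D)|
      = |((discMean c' χ (Ti D χ) : ℂ) - g * ((frakA χ * frakP D : ℝ) : ℂ)).re| := by
        rw [Complex.sub_re, Complex.ofReal_re, Complex.re_mul_ofReal]
    _ ≤ ‖((discMean c' χ (Ti D χ) : ℂ) - g * ((frakA χ * frakP D : ℝ) : ℂ))‖ := Complex.abs_re_le_norm _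
    _ ≤ ε * (frakA χ * frakP D) := h1

/-- **The Dict row, entry form:** a member of `familyGramBlockDict` whose `k²` entry rows hold (for `i ≤ j`, the model
matrix being Hermitian) satisfies the row's dichotomy — EITHER (A) fails eventually OR no amplitude vector closes.
[cite: Zhang2022LandauSiegel, §2 Lemma 2.3, Prop. 2.2 (i); §7 Prop 7.1 (7.2); §8 Lemma 8.1] -/
theorem familyGramBlockDict_of_entries (d : GramDesign) (Λs : BandScale) (hH : d.gram.IsHermitian)
    (h : ∀ i j, i ≤ j → PairDictionary c' (fun D χ => (d.piece i).table Λs D χ) (fun D χ => (d.piece j).table Λs D χ)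
      (d.gram i j))
    (h22 : Prop22i) (h23 : Lemma23 c') :
    (∃ D₀ : ℕ, ∀ (D : ℕ) [NeZero D] (χ : DirichletCharacter ℂ D),
        D₀ ≤ D → χ.IsQuadratic → χ.IsPrimitive → ¬ AssumptionA D χ)
      ∨ ∀ x : Fin d.k → ℂ, ¬ (gramForm d.gram x < 0) :=
  familyGramBlockAll_dichotomy d Λs hH (gramDictionary_of_upper hH h) h22 h23

end PairDictionary

end KnifeEdge

end Literature.NumberTheory.LFunctions.Zhang2022
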